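import Literature.NumberTheory.EllipticCurves.OggFormulaTwistTameTwoProofs
import Literature.NumberTheory.EllipticCurves.NeronComponentIndexTypeI0starProofs
import HarnessLib

/-!
# Ogg's formula at `2` over `ℚ`: the `C₆`-branches of Kodaira type `I₀*` (`ord₂ Δ_min = 8, 10`)

`Proofs` file (theorems only, no definitions, no named facts, no instances) in topic
`NumberTheory/EllipticCurves`, sequel of `OggFormulaTameTypesTwoProofs` and
`OggFormulaTwistTameTwoProofs` (same seat: the C15 fact
`WeierstrassCurve.conductorNatOf_geomPoints_eq_conductorNorm_of_isElliptic W ℓ`, `HasseWeilAbelian`;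
Serre–Tate 1968 §3, Silverman *ATAEC* §IV.10 and Ogg's formula IV.11.1).

## Context

The leaf of Ogg–Saito left over `ℚ` is `Sw_𝔓(E[3]) = δ₂(E)` for the elliptic curves `E/ℚ` additive
at `2` with `ord₂(j) > 0`, `j ≠ 0` (`OggFormulaPotGoodOrdinaryTwoProofs`, `OggFormulaJZeroTwoProofs`);
the inertia group acts on `E[3]` through `Φ ≤ SL₂(𝔽₃)`.  The tame curves (`Φ = C₃`: types `IV`,
`IV*`) and the Galois side of their ramified quadratic twists (`Φ = C₆`) are in the two previous
files, together with the first `C₆`-branch of Tate's algorithm, type `II` with `ord₂ Δ_min = 4`.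
This file settles the two `C₆`-branches of **type `I₀*`**:

* `ord₂ Δ_min = 8`: the twists by `χ₋₁` of the curves of type `IV*` (`δ₂ = 2`);
* `ord₂ Δ_min = 10`: the twists by `χ_{±2}` of the curves of type `IV` (`δ₂ = 4`).

## The argument (Silverman *ATAEC* IV.9.4 Step 6 with `π = 2`; Thm. IV.10.2(b), twist case)

* **Canonical normal forms** (§1, over a DVR in which `2` is a uniformiser, perfect residue field).
  The Step-6 model of a curve of type `I₀*` (`a₁ = 2α, a₂ = 2p, a₃ = 4γ, a₄ = 4q, a₆ = 8r₀`,
  `pq + r₀ ∈ R^×`) is first translated by `x ↦ x + 2c`, `c² ≡ q (mod 2)`, which makes `8 ∣ a₄` and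
  `a₆/8` a unit (`exists_smul_step6_eight_dvd_a₄_of_kodairaSymbolOfMinimal_eq_Istar_zero`) — the
  parity of `q` is *not* an invariant of the curve, the further dichotomies below are.  On such a
  model `Δ = 2⁸(γ⁴ + 2J)`, and if `2 ∣ γ` then `Δ = 2⁹(-rα⁶ + 2J')`, and if moreover `2 ∣ α` (after
  killing `a₃` by `y ↦ y - a₃/2`) `Δ = 2¹⁰(-27r² + 2J'')` (explicit polynomial identities): so
  `ord Δ = 8, 9, 10` according as `γ ∈ R^×`; `2 ∣ γ, α ∈ R^×`; `2 ∣ γ, 2 ∣ α`.  For `ord Δ = 8`: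
  `a₃ = 4γ`, `γ` a unit, and `b₈ = 32w` with the dichotomy `2 ∣ w` / `w ∈ R^×`
  (`…_of_addVal_eq_eight`); for `ord Δ = 10`: `4 ∣ a₁`, `a₃ = 0`, `a₆ = 8r`, `b₈ = 64w`, same
  dichotomy (`…_of_addVal_eq_ten`).
* **`ord₂ Δ_min = 8`, `2⁶ ∣ b₈`** (§§2–3, over `ℚ`).  On the `ℚ`-model
  (`exists_variableChange_valuation_a_b₈_of_two`) `2⁶ ∣ b₈` reads `α² + p ≡ 0 (mod 2)`, and the twist
  by `-1`, `y² = x³ - (α² + 2p)x² + 4(q₁ + αγ)x - 4(γ² + 2r)`, under `y ↦ y + sx + 2` (`s` the parity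
  of `α`) acquires the shape `2 ∣ a₁`, `4 ∣ a₂`, `a₃ = 4`, `8 ∣ a₄`, `16 ∣ a₆`, `ord₂ Δ = 8` of
  type `IV*`; hence `E^{(-1)}` is potentially good over `ℚ(∛2)`
  (`hasGoodReductionAt_baseChange_of_pow_three_eq`, `j = 2`) and `Sw_𝔓(V_ℓ E) = 2 · 1 = 2 = δ₂`
  (`swanConductorAt_rationalTate_eq_two_of_quadraticTwist_of_emod_four_eq_three`).
* **`ord₂ Δ_min = 10`, `2⁷ ∣ b₈`** (§4).  Here `2⁷ ∣ b₈` reads `p ≡ q₁ (mod 2)`; `a₆/8 = r` is a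
  `2`-adic unit, `≡ ε = ±1 (mod 4)`, and the twist by `2ε` rescaled by `(u; r, s, t) = (2; 0, 2s₀, 8)`
  (`s₀` the parity of `p`) has the shape `2 ∣ a₁, a₂`, `a₃ = 2`, `4 ∣ a₄, a₆`, `ord₂ Δ = 4` of type
  `IV` — the needed `2`-adic transfer of the normal form to `ℚ` keeps `a₃` only approximately `0`
  (`ord₂ a₃ ≥ 5`, `exists_variableChange_valuation_shape_of_two`), which is harmless.  Hence
  `E^{(2ε)}` is potentially good over `ℚ(∛2)` and `Sw_𝔓(V_ℓ E) = 2 · 2 = 4 = δ₂`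
  (`swanConductorAt_rationalTate_eq_four_of_quadraticTwist_of_emod_four_eq_two`).

## Main results (over `ℚ`, `v ∋ 2`, `W` elliptic of Kodaira type `I₀*` at `v`)

* `LocalIndex.exists_smul_a_of_kodairaSymbolOfMinimal_eq_Istar_zero_of_two_of_addVal_eq_eight / _ten`
  (DVR level) and
  `WeierstrassCurve.exists_variableChange_of_kodairaSymbolAt_Istar_zero_of_ordMinimalDiscriminant_eq_eight / _ten`
  (the dispatch over `ℚ`, with the `C₆` / non-`C₆` dichotomy on `b₈`);
* `WeierstrassCurve.swanConductorAt_rationalTate_eq_two_of_Istar_zero_eight_of_valuation_b₈_le`,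
  `WeierstrassCurve.swanConductorAt_torsion_eq_wildConductorExponent_of_Istar_zero_eight_of_valuation_b₈_le`
  — `Sw_𝔓(V_ℓ E) = 2` and `Sw_𝔓(E[3]) = δ₂ = 2` on the `C₆`-branch of `(I₀*, 8)`;
* `WeierstrassCurve.swanConductorAt_rationalTate_eq_four_of_Istar_zero_ten_of_valuation_b₈_le`,
  `WeierstrassCurve.swanConductorAt_torsion_eq_wildConductorExponent_of_Istar_zero_ten_of_valuation_b₈_le`
  — `Sw_𝔓(V_ℓ E) = 4` and `Sw_𝔓(E[3]) = δ₂ = 4` on the `C₆`-branch of `(I₀*, 10)`.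

The complementary branches (`b₈ = 32·unit`, resp. `64·unit`: inertia `SL₂(𝔽₃)`) and `(I₀*, 9)` are
not treated here.  No definitions, no named facts (D-0026).  All axioms `propext`,
`Classical.choice`, `Quot.sound`.

## References

* J. H. Silverman, *Advanced Topics in the Arithmetic of Elliptic Curves*, GTM 151 (1994), IV.9.4
  (Tate's algorithm, Steps 5–8) and Table 4.1; §IV.10 (Definition of `ε, δ, f`, PDF p. 358;
  Thm. 10.2(b) and its proof, pp. 359–362); §IV.11 (Ogg's formula 11.1, p. 365; `p = 2`, p. 366).
  [SilvermanATAEC1994]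
* J. H. Silverman, *The Arithmetic of Elliptic Curves*, 2nd ed. (2009), VII.1 Remark 1.1,
  VII.4.1(a), VII.5 Prop. 5.1 and Prop. 5.4, X.5 Cor. 5.4. [SilvermanAEC2009]
* J.-P. Serre, J. Tate, *Good reduction of abelian varieties*, Ann. of Math. 88 (1968), §§2–3.
  [SerreTate1968]
* J.-P. Serre, *Local Fields*, GTM 67 (1979), Ch. IV §§1–3, Ch. VI §2. [SerreLocalFields1979]
* T. Saito, *Conductor, discriminant, and the Noether formula of arithmetic surfaces*, Duke Math.
  J. 57 (1988), Theorem 1 (cited only). [Saito1988]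

## Design

Theorems only; `noncomputable section`.  §1 in `namespace Literature.NumberTheory.EllipticCurves.LocalIndex`
(DVR level, `2` a uniformiser) with the polynomial identities proved by `ring`; §2 (the transfer
lemma with the shapes of `a₃` and `a₆ - c`) and §§3–4 over `ℚ` in `namespace WeierstrassCurve`, with
the signatures of `OggFormulaTwistTameTwoProofs`.  Axioms: `propext`, `Classical.choice`, `Quot.sound`.
-/

noncomputable section

open scoped Classical NumberField
open NumberField IsDedekindDomain Field WithZero

/-! ## §1. Canonical normal forms of type `I₀*` when `2` is a uniformiser -/

section DVR

open IsLocalRing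
open IsDiscreteValuationRing hiding maximalIdeal

namespace Literature.NumberTheory.EllipticCurves

namespace LocalIndex

open Literature.NumberTheory.DiophantineGeometry Literature.NumberTheory.DiophantineGeometry.TateAlgorithm
  Literature.NumberTheory.DiophantineGeometry.TateAlgorithm.CharTwo

variable {R : Type*} [CommRing R] [IsDomain R] [IsDiscreteValuationRing R]

omit [IsDomain R] [IsDiscreteValuationRing R] in
/-- **`Δ = 2⁸(γ⁴ + 2J)` on a Step-6 model with `8 ∣ a₄`** (`a₁ = 2α`, `a₂ = 2p`, `a₃ = 4γ`,
`a₄ = 8q₁`, `a₆ = 8r`; the case `2 ∣ q` of the identity `Δ = 2⁸((α²q + γ²)² + 2J)` of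
`CharTwo.addVal_Δ_toNat_le_ten_of_step6`).  So `ord Δ = 8` iff `γ` is a unit. [folklore] -/
theorem Δ_eq_of_step6_of_eight_dvd_a₄ (W : WeierstrassCurve R) {α p γ q₁ r : R} (hα : W.a₁ = 2 * α)
    (hp : W.a₂ = 2 * p) (hγ : W.a₃ = 2 ^ 2 * γ) (hq : W.a₄ = 2 ^ 3 * q₁) (hr : W.a₆ = 2 ^ 3 * r) :
    W.Δ = 2 ^ 8 * (γ ^ 4 + 2 *
      (-p * α ^ 4 * γ ^ 2 + 2 * q₁ * α ^ 5 * γ - r * α ^ 6 + 8 * p * q₁ * α ^ 3 * γ - 6 * p * r * α ^ 4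
       - 4 * p ^ 2 * α ^ 2 * γ ^ 2 + 2 * q₁ ^ 2 * α ^ 4 + α ^ 3 * γ ^ 3 + 8 * p * q₁ ^ 2 * α ^ 2
       + 18 * p * α * γ ^ 3 + 8 * p ^ 2 * q₁ * α * γ - 12 * p ^ 2 * r * α ^ 2 - 4 * p ^ 3 * γ ^ 2
       - 30 * q₁ * α ^ 2 * γ ^ 2 + 18 * r * α ^ 3 * γ + 36 * p * q₁ * γ ^ 2 + 36 * p * r * α * γ
       + 8 * p ^ 2 * q₁ ^ 2 - 8 * p ^ 3 * r + 36 * q₁ * r * α ^ 2 - 96 * q₁ ^ 2 * α * γ - 14 * γ ^ 4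
       + 72 * p * q₁ * r - 64 * q₁ ^ 3 - 54 * r * γ ^ 2 - 54 * r ^ 2)) := by
  simp only [WeierstrassCurve.Δ, WeierstrassCurve.b₂, WeierstrassCurve.b₄,
    WeierstrassCurve.b₆, WeierstrassCurve.b₈, hα, hp, hγ, hq, hr]
  ring

omit [IsDomain R] [IsDiscreteValuationRing R] in
/-- **`Δ = 2⁹(-rα⁶ + 2J)` on a Step-6 model with `8 ∣ a₃, a₄`** (`a₁ = 2α`, `a₂ = 2p`, `a₃ = 8γ₁`,
`a₄ = 8q₁`, `a₆ = 8r`).  So `ord Δ = 9` iff `r`, `α` are units, and `ord Δ ≥ 10` iff moreover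
`2 ∣ α` (for `r` a unit). [folklore] -/
theorem Δ_eq_of_step6_of_eight_dvd_a₃_a₄ (W : WeierstrassCurve R) {α p γ₁ q₁ r : R} (hα : W.a₁ = 2 * α)
    (hp : W.a₂ = 2 * p) (hγ : W.a₃ = 2 ^ 3 * γ₁) (hq : W.a₄ = 2 ^ 3 * q₁) (hr : W.a₆ = 2 ^ 3 * r) :
    W.Δ = 2 ^ 9 * (-(r * α ^ 6) + 2 *
      (-2 * p * α ^ 4 * γ₁ ^ 2 + 2 * q₁ * α ^ 5 * γ₁ + 8 * p * q₁ * α ^ 3 * γ₁ - 3 * p * r * α ^ 4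
       - 8 * p ^ 2 * α ^ 2 * γ₁ ^ 2 + q₁ ^ 2 * α ^ 4 + 4 * α ^ 3 * γ₁ ^ 3 + 4 * p * q₁ ^ 2 * α ^ 2
       + 72 * p * α * γ₁ ^ 3 + 8 * p ^ 2 * q₁ * α * γ₁ - 6 * p ^ 2 * r * α ^ 2 - 8 * p ^ 3 * γ₁ ^ 2
       - 60 * q₁ * α ^ 2 * γ₁ ^ 2 + 18 * r * α ^ 3 * γ₁ + 72 * p * q₁ * γ₁ ^ 2 + 36 * p * r * α * γ₁
       + 4 * p ^ 2 * q₁ ^ 2 - 4 * p ^ 3 * r + 18 * q₁ * r * α ^ 2 - 96 * q₁ ^ 2 * α * γ₁ - 108 * γ₁ ^ 4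
       + 36 * p * q₁ * r - 32 * q₁ ^ 3 - 108 * r * γ₁ ^ 2 - 27 * r ^ 2)) := by
  simp only [WeierstrassCurve.Δ, WeierstrassCurve.b₂, WeierstrassCurve.b₄,
    WeierstrassCurve.b₆, WeierstrassCurve.b₈, hα, hp, hγ, hq, hr]
  ring

omit [IsDomain R] [IsDiscreteValuationRing R] in
/-- **`Δ = 2¹⁰(-27r² + 2J)` on the model `a₁ = 4α₁`, `a₂ = 2p`, `a₃ = 0`, `a₄ = 8q₁`, `a₆ = 8r`**
(type `I₀*` with `ord Δ = 10`, canonical form).  So `ord Δ = 10` iff `r` is a unit. [folklore] -/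
theorem Δ_eq_of_a₃_eq_zero_of_sixteen (W : WeierstrassCurve R) {α₁ p q₁ r : R} (hα : W.a₁ = 2 ^ 2 * α₁)
    (hp : W.a₂ = 2 * p) (hγ : W.a₃ = 0) (hq : W.a₄ = 2 ^ 3 * q₁) (hr : W.a₆ = 2 ^ 3 * r) :
    W.Δ = 2 ^ 10 * (-(27 * r ^ 2) + 2 *
      (-16 * r * α₁ ^ 6 - 24 * p * r * α₁ ^ 4 + 8 * q₁ ^ 2 * α₁ ^ 4 + 8 * p * q₁ ^ 2 * α₁ ^ 2
       - 12 * p ^ 2 * r * α₁ ^ 2 + 2 * p ^ 2 * q₁ ^ 2 - 2 * p ^ 3 * r + 36 * q₁ * r * α₁ ^ 2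
       + 18 * p * q₁ * r - 16 * q₁ ^ 3)) := by
  simp only [WeierstrassCurve.Δ, WeierstrassCurve.b₂, WeierstrassCurve.b₄,
    WeierstrassCurve.b₆, WeierstrassCurve.b₈, hα, hp, hγ, hq, hr]
  ring

/-- **Type `I₀*` when `2` is a uniformiser: a Step-6 model with `8 ∣ a₄`.**  If Tate's algorithm
returns `I₀*` on a minimal `V` (`Δ ≠ 0`) then some `R`-model `D • V` has `a₁ = 2α`, `a₂ = 2p`,
`a₃ = 4γ`, `a₄ = 8q₁`, `a₆ = 8r` with `r ∈ R^×`, and the same `ord Δ`.  Start from the Step-6 model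
(`exists_smul_of_kodairaSymbolOfMinimal_eq_Istar_zero`: `a₄ = 4q`, `a₆ = 8r₀`, the cubic
`T³ + p̄T² + q̄T + r̄₀` having distinct roots, i.e. `pq + r₀ ∈ R^×`,
`CharTwo.isUnit_of_distinctRootCount_cubicStep6_eq_three`) and translate `x ↦ x + 2c` with
`c² ≡ q (mod 2)` (perfect residue field): the new `a₄ = 4(q - c²) + 8(cp + 2c²) ∈ 8R` and the new
`a₆/8 = (pq + r₀) + 2((c - p)(q - c²)/2 + c³)` is a unit.  Silverman, *ATAEC* IV.9.4 Step 6 with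
`π = 2`. [cite: SilvermanATAEC1994, IV.9.4 Step 6] -/
theorem exists_smul_step6_eight_dvd_a₄_of_kodairaSymbolOfMinimal_eq_Istar_zero
    [PerfectField (ResidueField R)] (h2 : Irreducible (2 : R)) (V : WeierstrassCurve R) (hΔ0 : V.Δ ≠ 0)
    (hV : V.kodairaSymbolOfMinimal = .Istar 0) :
    ∃ (D : WeierstrassCurve.VariableChange R) (α p γ q₁ r : R),
      (D • V).a₁ = 2 * α ∧ (D • V).a₂ = 2 * p ∧ (D • V).a₃ = 2 ^ 2 * γ ∧ (D • V).a₄ = 2 ^ 3 * q₁ ∧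
      (D • V).a₆ = 2 ^ 3 * r ∧ IsUnit r ∧ addVal R (D • V).Δ = addVal R V.Δ := by
  have hm : ∀ {x : R}, x ∈ maximalIdeal R ↔ (2 : R) ∣ x := fun {x} ↦
    mem_maximalIdeal_iff_dvd_of_irreducible h2 x
  have hmn : ∀ {x : R} {n : ℕ}, x ∈ maximalIdeal R ^ n ↔ (2 : R) ^ n ∣ x := fun {x n} ↦
    mem_maximalIdeal_pow_iff_dvd_of_irreducible h2 x n
  obtain ⟨D₀, h₁, h₂, h₃, h₄, h₆, h3⟩ := exists_smul_of_kodairaSymbolOfMinimal_eq_Istar_zero V hΔ0 hV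
  set N := D₀ • V with hN
  rw [hm] at h₁ h₂
  rw [hmn] at h₃ h₄ h₆
  obtain ⟨α, hα⟩ := h₁
  obtain ⟨p, hp⟩ := h₂
  obtain ⟨γ, hγ⟩ := h₃
  obtain ⟨q, hq⟩ := h₄
  obtain ⟨r, hr⟩ := h₆
  have hpqr : IsUnit (p * q + r) := isUnit_of_distinctRootCount_cubicStep6_eq_three h2 hp hq hr h3
  have hordN : addVal R N.Δ = addVal R V.Δ := by
    rw [hN, WeierstrassCurve.variableChange_Δ, addVal_mul, addVal_pow, addVal_eq_zero_of_unit,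
      nsmul_zero, zero_add]
  -- `c` with `c² ≡ q (mod 2)`
  have hres : (0 : ResidueField R) ^ 2 + 4 * residue R q = 0 := by
    rw [residue_four_eq_zero h2]; ring
  obtain ⟨σ, -, hσ⟩ := exists_root_step6 _ _ hres
  obtain ⟨c, rfl⟩ := residue_surjective σ
  have hcq : (2 : R) ∣ (q - c ^ 2) := by
    rw [← hm, ← residue_eq_zero_iff, map_sub, map_pow]
    rw [zero_mul, add_zero] at hσ
    rw [show residue R q - residue R c ^ 2 = -(residue R c ^ 2 - residue R q) by ring, hσ, neg_zero]
  obtain ⟨e, he⟩ := hcq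
  -- the translation `x ↦ x + 2c`
  set C : WeierstrassCurve.VariableChange R := ⟨1, 2 * c, 0, 0⟩ with hC
  set N' := C • N with hN'
  have e₁ : N'.a₁ = 2 * α := by
    rw [hN', WeierstrassCurve.variableChange_a₁, hC, hα]; simp
  have e₂ : N'.a₂ = 2 * (p + 3 * c) := by
    rw [hN', WeierstrassCurve.variableChange_a₂, hC, hp, hα]; simp; ring
  have e₃ : N'.a₃ = 2 ^ 2 * (γ + c * α) := by
    rw [hN', WeierstrassCurve.variableChange_a₃, hC, hγ, hα]; simp; ring
  have e₄ : N'.a₄ = 2 ^ 3 * (e + c * p + 2 * c ^ 2) := by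
    rw [hN', WeierstrassCurve.variableChange_a₄, hC, hq, hp, hγ, hα]; simp
    linear_combination (4 : R) * he
  have e₆ : N'.a₆ = 2 ^ 3 * (r + c * q + c ^ 2 * p + c ^ 3) := by
    rw [hN', WeierstrassCurve.variableChange_a₆, hC, hr, hq, hp, hγ, hα]; simp; ring
  have hΔ' : N'.Δ = N.Δ := by
    rw [hN']; exact Δ_smul_of_u_eq_one rfl N
  have hr' : IsUnit (r + c * q + c ^ 2 * p + c ^ 3) := by
    have eq : r + c * q + c ^ 2 * p + c ^ 3 = (p * q + r) + 2 * ((c - p) * e + c ^ 3) := by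
      linear_combination (c - p) * he
    rw [eq]; exact isUnit_add_mul_of_isUnit h2 hpqr _
  refine ⟨C * D₀, α, p + 3 * c, γ + c * α, e + c * p + 2 * c ^ 2, r + c * q + c ^ 2 * p + c ^ 3, ?_⟩
  rw [mul_smul, ← hN, ← hN']
  exact ⟨e₁, e₂, e₃, e₄, e₆, hr', by rw [hΔ', hordN]⟩

/-- **Type `I₀*` with `ord Δ = 8` when `2` is a uniformiser: a canonical normal form.**  Some
`R`-model has `2 ∣ a₁, a₂`, `a₃ = 4γ` with `γ ∈ R^×`, `8 ∣ a₄`, `a₆ = 8r` with `r ∈ R^×`, and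
`b₈ = 32w` with the dichotomy `2 ∣ w` (`2⁶ ∣ b₈`: `Φ = C₆`) or `w ∈ R^×`: on the Step-6 model with
`8 ∣ a₄` (`exists_smul_step6_eight_dvd_a₄_of_kodairaSymbolOfMinimal_eq_Istar_zero`), `a₃/4` is a unit
because otherwise `2⁹ ∣ Δ` (`Δ_eq_of_step6_of_eight_dvd_a₃_a₄`), and
`b₈ = 32(α²r + 2pr - 2αγq₁ + pγ² - 2q₁²)`.  Silverman, *ATAEC* IV.9.4 Step 6 with `π = 2` (Table 4.1:
over `ℚ₂`, type `I₀*` with `f = 4`). [cite: SilvermanATAEC1994, IV.9.4 Step 6] -/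
theorem exists_smul_a_of_kodairaSymbolOfMinimal_eq_Istar_zero_of_two_of_addVal_eq_eight
    [PerfectField (ResidueField R)] (h2 : Irreducible (2 : R)) (V : WeierstrassCurve R)
    (hV : V.kodairaSymbolOfMinimal = .Istar 0) (hΔ : (addVal R V.Δ).toNat = 8) :
    ∃ D : WeierstrassCurve.VariableChange R,
      2 ∣ (D • V).a₁ ∧ 2 ∣ (D • V).a₂ ∧ (∃ γ : R, IsUnit γ ∧ (D • V).a₃ = 2 ^ 2 * γ) ∧
      2 ^ 3 ∣ (D • V).a₄ ∧ (∃ r : R, IsUnit r ∧ (D • V).a₆ = 2 ^ 3 * r) ∧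
      ((2 : R) ^ 6 ∣ (D • V).b₈ ∨ ∃ w : R, IsUnit w ∧ (D • V).b₈ = 2 ^ 5 * w) ∧
      (addVal R (D • V).Δ).toNat = 8 := by
  have hΔ0 : V.Δ ≠ 0 := by
    intro h0; rw [h0] at hΔ; simp at hΔ
  obtain ⟨D, α, p, γ, q₁, r, e₁, e₂, e₃, e₄, e₆, hr, hord⟩ :=
    exists_smul_step6_eight_dvd_a₄_of_kodairaSymbolOfMinimal_eq_Istar_zero h2 V hΔ0 hV
  set N := D • V with hN
  have hordN : (addVal R N.Δ).toNat = 8 := by rw [hord, hΔ]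
  have hN0 : N.Δ ≠ 0 := by
    intro h0; rw [h0] at hordN; simp at hordN
  -- `a₃ / 4` is a unit
  have hγ : IsUnit γ := by
    rw [isUnit_iff_not_dvd h2]
    rintro ⟨γ₁, hγ₁⟩
    have h9 : (2 : R) ^ 9 ∣ N.Δ :=
      ⟨_, Δ_eq_of_step6_of_eight_dvd_a₃_a₄ N e₁ e₂ (by rw [e₃, hγ₁]; ring) e₄ e₆⟩
    have := le_addVal_toNat_of_pow_dvd h2 hN0 h9
    omega
  -- `b₈ = 32 w`
  have hb₈ : N.b₈ = 2 ^ 5 * (α ^ 2 * r + 2 * p * r - 2 * α * γ * q₁ + p * γ ^ 2 - 2 * q₁ ^ 2) := by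
    rw [WeierstrassCurve.b₈, e₁, e₂, e₃, e₄, e₆]; ring
  have hb₈' : (2 : R) ^ 6 ∣ N.b₈ ∨ ∃ w : R, IsUnit w ∧ N.b₈ = 2 ^ 5 * w := by
    by_cases hw : IsUnit (α ^ 2 * r + 2 * p * r - 2 * α * γ * q₁ + p * γ ^ 2 - 2 * q₁ ^ 2)
    · exact Or.inr ⟨_, hw, hb₈⟩
    · obtain ⟨w₁, hw₁⟩ := (not_isUnit_iff_dvd h2 _).mp hw
      exact Or.inl ⟨w₁, by rw [hb₈, hw₁]; ring⟩
  exact ⟨D, ⟨α, e₁⟩, ⟨_, e₂⟩, ⟨γ, hγ, e₃⟩, ⟨_, e₄⟩, ⟨r, hr, e₆⟩, hb₈', hordN⟩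

/-- **Type `I₀*` with `ord Δ = 10` when `2` is a uniformiser: a canonical normal form.**  Some
`R`-model has `4 ∣ a₁`, `2 ∣ a₂`, `a₃ = 0`, `8 ∣ a₄`, `a₆ = 8r` with `r ∈ R^×`, and `b₈ = 64w`
with the dichotomy `2 ∣ w` (`2⁷ ∣ b₈`: `Φ = C₆`) or `w ∈ R^×`: on the Step-6 model with `8 ∣ a₄`,
`ord Δ = 10` forces `2 ∣ a₃/4` (else `ord Δ = 8`, `Δ_eq_of_step6_of_eight_dvd_a₄`) and then `2 ∣ a₁/2`
(else `ord Δ = 9`, `Δ_eq_of_step6_of_eight_dvd_a₃_a₄`); the translation `y ↦ y - a₃/2` then kills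
`a₃` (`a₆/8` becomes `r + 2(a₃/8)²`, still a unit), and `b₈ = 64(2α₁²r + pr - q₁²)` for `a₁ = 4α₁`.
Silverman, *ATAEC* IV.9.4 Step 6 with `π = 2` (Table 4.1: over `ℚ₂`, type `I₀*` with `f = 6`).
[cite: SilvermanATAEC1994, IV.9.4 Step 6] -/
theorem exists_smul_a_of_kodairaSymbolOfMinimal_eq_Istar_zero_of_two_of_addVal_eq_ten
    [PerfectField (ResidueField R)] (h2 : Irreducible (2 : R)) (V : WeierstrassCurve R)
    (hV : V.kodairaSymbolOfMinimal = .Istar 0) (hΔ : (addVal R V.Δ).toNat = 10) :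
    ∃ D : WeierstrassCurve.VariableChange R,
      2 ^ 2 ∣ (D • V).a₁ ∧ 2 ∣ (D • V).a₂ ∧ (D • V).a₃ = 0 ∧ 2 ^ 3 ∣ (D • V).a₄ ∧
      (∃ r : R, IsUnit r ∧ (D • V).a₆ = 2 ^ 3 * r) ∧
      ((2 : R) ^ 7 ∣ (D • V).b₈ ∨ ∃ w : R, IsUnit w ∧ (D • V).b₈ = 2 ^ 6 * w) ∧
      (addVal R (D • V).Δ).toNat = 10 := by
  have hΔ0 : V.Δ ≠ 0 := by
    intro h0; rw [h0] at hΔ; simp at hΔ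
  obtain ⟨D, α, p, γ, q₁, r, e₁, e₂, e₃, e₄, e₆, hr, hord⟩ :=
    exists_smul_step6_eight_dvd_a₄_of_kodairaSymbolOfMinimal_eq_Istar_zero h2 V hΔ0 hV
  set N := D • V with hN
  have hordN : (addVal R N.Δ).toNat = 10 := by rw [hord, hΔ]
  -- `2 ∣ γ`
  have hγ : (2 : R) ∣ γ := by
    by_contra hγu
    rw [← isUnit_iff_not_dvd h2] at hγu
    have := addVal_toNat_eq_of_two h2 (hγu.pow 4) (Δ_eq_of_step6_of_eight_dvd_a₄ N e₁ e₂ e₃ e₄ e₆)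
    omega
  obtain ⟨γ₁, rfl⟩ := hγ
  have e₃' : N.a₃ = 2 ^ 3 * γ₁ := by rw [e₃]; ring
  -- `2 ∣ α`
  have hα : (2 : R) ∣ α := by
    by_contra hαu
    rw [← isUnit_iff_not_dvd h2] at hαu
    have := addVal_toNat_eq_of_two h2 ((hr.mul (hαu.pow 6)).neg)
      (Δ_eq_of_step6_of_eight_dvd_a₃_a₄ N e₁ e₂ e₃' e₄ e₆)
    omega
  obtain ⟨α₁, rfl⟩ := hα
  have e₁' : N.a₁ = 2 ^ 2 * α₁ := by rw [e₁]; ring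
  -- the translation `y ↦ y - 4γ₁`
  set C : WeierstrassCurve.VariableChange R := ⟨1, 0, 0, -(4 * γ₁)⟩ with hC
  set N' := C • N with hN'
  have f₁ : N'.a₁ = 2 ^ 2 * α₁ := by
    rw [hN', WeierstrassCurve.variableChange_a₁, hC, e₁']; simp
  have f₂ : N'.a₂ = 2 * p := by
    rw [hN', WeierstrassCurve.variableChange_a₂, hC, e₂, e₁']; simp
  have f₃ : N'.a₃ = 0 := by
    rw [hN', WeierstrassCurve.variableChange_a₃, hC, e₃', e₁']; simp; ring
  have f₄ : N'.a₄ = 2 ^ 3 * (q₁ + 2 * α₁ * γ₁) := by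
    rw [hN', WeierstrassCurve.variableChange_a₄, hC, e₄, e₃', e₂, e₁']; simp; ring
  have f₆ : N'.a₆ = 2 ^ 3 * (r + 2 * γ₁ ^ 2) := by
    rw [hN', WeierstrassCurve.variableChange_a₆, hC, e₆, e₄, e₃', e₂, e₁']; simp; ring
  have hΔ' : N'.Δ = N.Δ := by
    rw [hN']; exact Δ_smul_of_u_eq_one rfl N
  have hordN' : (addVal R N'.Δ).toNat = 10 := by rw [hΔ', hordN]
  have hr' : IsUnit (r + 2 * γ₁ ^ 2) := isUnit_add_mul_of_isUnit h2 hr _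
  have hb₈ : N'.b₈ = 2 ^ 6 * (2 * α₁ ^ 2 * (r + 2 * γ₁ ^ 2) + p * (r + 2 * γ₁ ^ 2) -
      (q₁ + 2 * α₁ * γ₁) ^ 2) := by
    rw [WeierstrassCurve.b₈, f₁, f₂, f₃, f₄, f₆]; ring
  have hb₈' : (2 : R) ^ 7 ∣ N'.b₈ ∨ ∃ w : R, IsUnit w ∧ N'.b₈ = 2 ^ 6 * w := by
    by_cases hw : IsUnit (2 * α₁ ^ 2 * (r + 2 * γ₁ ^ 2) + p * (r + 2 * γ₁ ^ 2) - (q₁ + 2 * α₁ * γ₁) ^ 2)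
    · exact Or.inr ⟨_, hw, hb₈⟩
    · obtain ⟨w₁, hw₁⟩ := (not_isUnit_iff_dvd h2 _).mp hw
      exact Or.inl ⟨w₁, by rw [hb₈, hw₁]; ring⟩
  refine ⟨C * D, ?_⟩
  rw [mul_smul, ← hN, ← hN']
  exact ⟨⟨α₁, f₁⟩, ⟨p, f₂⟩, f₃, ⟨_, f₄⟩, ⟨_, hr', f₆⟩, hb₈', hordN'⟩

end LocalIndex

end Literature.NumberTheory.EllipticCurves

end DVR

/-! ## §2. Tate's normal forms at an absolutely unramified place above `2` made `K`-rational (shapes of `a₃`, `a₆ - c`, `b₈`) -/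

section Transfer

open IsLocalRing
open IsDiscreteValuationRing hiding maximalIdeal

namespace WeierstrassCurve

open Literature.NumberTheory.EllipticCurves Literature.NumberTheory.DiophantineGeometry
  Literature.NumberTheory.DiophantineGeometry.TateAlgorithm Literature.NumberTheory.GaloisRepresentations
  IsDedekindDomain.HeightOneSpectrum

section Dedekind

variable {A : Type*} [CommRing A] [IsDedekindDomain A] {K' : Type*} [Field K'] [Algebra A K']
  [IsFractionRing A K'] (v : HeightOneSpectrum A) (X : WeierstrassCurve K')

/-- **From an `𝒪_v`-model with `2`-power shapes to a `K`-model, with the shapes of `a₃` (divisible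
mode), `a₆ - c` and `b₈`** (`ord_v(2) = 1`).  If an `𝒪_v`-change of variables `D` of the integral local
minimal model `M` at `v` has `2^{k₁} ∣ a₁`, `2^{k₂} ∣ a₂`, `2^{k₃} ∣ a₃`, `2^{k₄} ∣ a₄`,
`a₆ = 2^{k₆}·unit`, `2^{k₆'} ∣ a₆ - c` (`c ∈ ℤ`), `2^{k₈} ∣ b₈` and `ord Δ = n`, then `ord_v(Δ_min) = n`
and some change of variables **over `K`** gives a model `C • X` with `ord_v(a₁) ≥ k₁`, `ord_v(a₂) ≥ k₂`,
`ord_v(a₃) ≥ k₃`, `ord_v(a₄) ≥ k₄`, `ord_v(a₆) = k₆`, `ord_v(a₆ - c) ≥ k₆'`, `ord_v(b₈) ≥ k₈`,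
`ord_v(Δ) = n`, and moreover `ord_v(a₃) = m` (resp. `ord_v(b₈) = m`) whenever `a₃(D • M)` (resp.
`b₈(D • M)`) is `2^m·unit` (density of `K⁴` in `K_v⁴`; the argument of
`exists_variableChange_valuation_a_b₈_of_two`, `OggFormulaTwistTameTwoProofs`).  Silverman, *AEC*
VII.1 Remark 1.1; *ATAEC* IV.9.4. [cite: SilvermanAEC2009, VII.1 Remark 1.1]
[cite: SilvermanATAEC1994, IV.9.4] -/
theorem exists_variableChange_valuation_shape_of_two [X.IsElliptic]
    (h2 : v.valuation K' (2 : K') = exp (-1 : ℤ)) {k₁ k₂ k₃ k₄ k₆ k₈ n : ℕ}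
    (D : VariableChange (v.adicCompletionIntegers K'))
    (ha₁ : (2 : v.adicCompletionIntegers K') ^ k₁ ∣ (D • X.localMinimalIntegralModel v).a₁)
    (ha₂ : (2 : v.adicCompletionIntegers K') ^ k₂ ∣ (D • X.localMinimalIntegralModel v).a₂)
    (ha₃ : (2 : v.adicCompletionIntegers K') ^ k₃ ∣ (D • X.localMinimalIntegralModel v).a₃)
    (ha₄ : (2 : v.adicCompletionIntegers K') ^ k₄ ∣ (D • X.localMinimalIntegralModel v).a₄)
    (ha₆' : ∃ r : v.adicCompletionIntegers K', IsUnit r ∧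
      (D • X.localMinimalIntegralModel v).a₆ = 2 ^ k₆ * r)
    (c₆ : ℤ) {k₆' : ℕ}
    (ha₆c : (2 : v.adicCompletionIntegers K') ^ k₆' ∣ ((D • X.localMinimalIntegralModel v).a₆ - c₆))
    (hb₈ : (2 : v.adicCompletionIntegers K') ^ k₈ ∣ (D • X.localMinimalIntegralModel v).b₈)
    (hΔn : (addVal (v.adicCompletionIntegers K') (D • X.localMinimalIntegralModel v).Δ).toNat = n) :
    X.ordMinimalDiscriminant v = n ∧
    ∃ C : VariableChange K',
      v.valuation K' (C • X).a₁ ≤ exp (-(k₁ : ℤ)) ∧ v.valuation K' (C • X).a₂ ≤ exp (-(k₂ : ℤ)) ∧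
      v.valuation K' (C • X).a₃ ≤ exp (-(k₃ : ℤ)) ∧
      (∀ {m : ℕ} {w : v.adicCompletionIntegers K'}, IsUnit w →
        (D • X.localMinimalIntegralModel v).a₃ = 2 ^ m * w → v.valuation K' (C • X).a₃ = exp (-(m : ℤ))) ∧
      v.valuation K' (C • X).a₄ ≤ exp (-(k₄ : ℤ)) ∧
      v.valuation K' (C • X).a₆ = exp (-(k₆ : ℤ)) ∧
      v.valuation K' ((C • X).a₆ - c₆) ≤ exp (-(k₆' : ℤ)) ∧
      v.valuation K' (C • X).b₈ ≤ exp (-(k₈ : ℤ)) ∧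
      (∀ {m : ℕ} {w : v.adicCompletionIntegers K'}, IsUnit w →
        (D • X.localMinimalIntegralModel v).b₈ = 2 ^ m * w → v.valuation K' (C • X).b₈ = exp (-(m : ℤ))) ∧
      v.valuation K' (C • X).Δ = exp (-(n : ℤ)) := by
  set φ := algebraMap K' (v.adicCompletion K') with hφ
  -- `2` is a uniformiser of `(v.adicCompletionIntegers K')`
  have h2v : Valued.v ((2 : (v.adicCompletionIntegers K')) : (v.adicCompletion K')) = exp (-1 : ℤ) := by
    have : ((2 : (v.adicCompletionIntegers K')) : (v.adicCompletion K')) = φ 2 := by rw [hφ, map_ofNat]; rfl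
    rw [this, hφ, valued_algebraMap_adicCompletion, h2]
  have h2irr : Irreducible (2 : (v.adicCompletionIntegers K')) := irreducible_adicCompletionIntegers_of_valued_eq v 2 h2v
  set M := X.localMinimalIntegralModel v with hM
  obtain ⟨r, hr, ha₆⟩ := ha₆'
  set N := D • M with hN
  -- `ord_v(Δ_min) = n`
  have hΔM0 : M.Δ ≠ 0 := localMinimalIntegralModel_Δ_ne_zero v X
  have hΔN : N.Δ = ↑D.u⁻¹ ^ 12 * M.Δ := by rw [hN, variableChange_Δ]
  have hordN : addVal (v.adicCompletionIntegers K') N.Δ = addVal (v.adicCompletionIntegers K') M.Δ := by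
    rw [hΔN, addVal_mul, addVal_pow, addVal_eq_zero_of_unit, nsmul_zero, zero_add]
  have hord : X.ordMinimalDiscriminant v = n := by
    rw [ordMinimalDiscriminant, ← hM, ← hordN, hΔn]
  refine ⟨hord, ?_⟩
  -- valuations of the coefficients of `N` in `K_v`
  have hle : ∀ {x : (v.adicCompletionIntegers K')} {k : ℕ}, (2 : (v.adicCompletionIntegers K')) ^ k ∣ x → Valued.v (x : (v.adicCompletion K')) ≤ exp (-(k : ℤ)) := by
    rintro x k ⟨y, rfl⟩
    push_cast
    rw [Valuation.map_mul, Valuation.map_pow, h2v, ← exp_nsmul, nsmul_eq_mul, mul_neg, mul_one]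
    exact mul_le_of_le_one_right' ((mem_adicCompletionIntegers _ _ _).mp y.2)
  have heq : ∀ {x : (v.adicCompletionIntegers K')} {k : ℕ} {w : (v.adicCompletionIntegers K')}, IsUnit w → x = 2 ^ k * w →
      Valued.v (x : (v.adicCompletion K')) = exp (-(k : ℤ)) := by
    rintro x k w hw rfl
    push_cast
    rw [Valuation.map_mul, Valuation.map_pow, h2v, ← exp_nsmul, nsmul_eq_mul, mul_neg, mul_one,
      adicCompletionIntegers.isUnit_iff_valued_eq_one.mp hw, mul_one]
  have hN₁ : Valued.v (N.a₁ : (v.adicCompletion K')) ≤ exp (-(k₁ : ℤ)) := hle ha₁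
  have hN₂ : Valued.v (N.a₂ : (v.adicCompletion K')) ≤ exp (-(k₂ : ℤ)) := hle ha₂
  have hN₄ : Valued.v (N.a₄ : (v.adicCompletion K')) ≤ exp (-(k₄ : ℤ)) := hle ha₄
  have hN₈ : Valued.v (N.b₈ : (v.adicCompletion K')) ≤ exp (-(k₈ : ℤ)) := hle hb₈
  have hN₃ : Valued.v (N.a₃ : (v.adicCompletion K')) ≤ exp (-(k₃ : ℤ)) := hle ha₃
  have hN₆ : Valued.v (N.a₆ : (v.adicCompletion K')) = exp (-(k₆ : ℤ)) := heq hr ha₆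
  have hN₆c : Valued.v ((N.a₆ : (v.adicCompletion K')) - (c₆ : v.adicCompletion K')) ≤ exp (-(k₆' : ℤ)) := by
    have := hle ha₆c
    push_cast at this
    exact this
  have hNΔ0 : N.Δ ≠ 0 := by
    rw [hΔN]; exact mul_ne_zero (pow_ne_zero _ (Units.ne_zero _)) hΔM0
  have hNΔ : Valued.v (N.Δ : (v.adicCompletion K')) = exp (-(n : ℤ)) := by
    obtain ⟨m, u₀, hmu⟩ := eq_unit_mul_pow_irreducible hNΔ0 h2irr
    have hm : m = n := by
      have h := addVal_def N.Δ u₀ h2irr m hmu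
      rw [← hΔn, h]; simp
    rw [hmu]
    push_cast
    rw [Valuation.map_mul, Valuation.map_pow, h2v, ← exp_nsmul, nsmul_eq_mul, mul_neg, mul_one,
      adicCompletionIntegers.isUnit_iff_valued_eq_one.mp (Units.isUnit u₀), one_mul, hm]
  -- the `K_v`-model `C • X_v = N`
  obtain ⟨C₀, hC₀⟩ : ∃ C₀ : VariableChange (v.adicCompletion K'), C₀ • X.baseChange (v.adicCompletion K') = X.localMinimalModel v :=
    ⟨_, rfl⟩
  have hMK : M.map (algebraMap (v.adicCompletionIntegers K') (v.adicCompletion K')) = X.localMinimalModel v := by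
    rw [hM, localMinimalIntegralModel]
    exact baseChange_integralModel_eq (v.adicCompletionIntegers K') (X.localMinimalModel v)
  set C : VariableChange (v.adicCompletion K') := D.map (algebraMap (v.adicCompletionIntegers K') (v.adicCompletion K')) * C₀ with hC
  set Xv := X.baseChange (v.adicCompletion K') with hXv
  have hNK : N.map (algebraMap (v.adicCompletionIntegers K') (v.adicCompletion K')) = C • Xv := by
    rw [hC, mul_smul, hXv, hC₀, ← hMK, hN, map_variableChange]
  have hC₁ : Valued.v (C • Xv).a₁ ≤ exp (-(k₁ : ℤ)) := by rw [← hNK, map_a₁]; exact hN₁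
  have hC₂ : Valued.v (C • Xv).a₂ ≤ exp (-(k₂ : ℤ)) := by rw [← hNK, map_a₂]; exact hN₂
  have hC₃ : Valued.v (C • Xv).a₃ ≤ exp (-(k₃ : ℤ)) := by rw [← hNK, map_a₃]; exact hN₃
  have hC₆c : Valued.v ((C • Xv).a₆ - (c₆ : v.adicCompletion K')) ≤ exp (-(k₆' : ℤ)) := by
    rw [← hNK, map_a₆]; exact hN₆c
  have hC₄ : Valued.v (C • Xv).a₄ ≤ exp (-(k₄ : ℤ)) := by rw [← hNK, map_a₄]; exact hN₄
  have hC₆ : Valued.v (C • Xv).a₆ = exp (-(k₆ : ℤ)) := by rw [← hNK, map_a₆]; exact hN₆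
  have hC₈ : Valued.v (C • Xv).b₈ ≤ exp (-(k₈ : ℤ)) := by rw [← hNK, map_b₈]; exact hN₈
  have hCΔ : Valued.v (C • Xv).Δ = exp (-(n : ℤ)) := by rw [← hNK, map_Δ]; exact hNΔ
  -- continuity of `b₈` in the parameters
  have hb₈c : Continuous fun p ↦ (Xv.polyVariableChange p).b₈ := by
    have h1 := Xv.continuous_polyVariableChange_a₁
    have h2 := Xv.continuous_polyVariableChange_a₂
    have h3 := Xv.continuous_polyVariableChange_a₃
    have h4 := Xv.continuous_polyVariableChange_a₄
    have h6 := Xv.continuous_polyVariableChange_a₆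
    simp only [WeierstrassCurve.b₈]
    exact ((((h1.pow 2).mul h6).add ((continuous_const.mul h2).mul h6)).sub
      ((h1.mul h3).mul h4)).add (h2.mul (h3.pow 2)) |>.sub (h4.pow 2)
  -- approximation of `(u⁻¹, r, s, t)` by elements of `K`
  have hu0 : Valued.v (↑C.u⁻¹ : (v.adicCompletion K')) ≠ 0 := by simp
  set p₀ : (v.adicCompletion K') × (v.adicCompletion K') × (v.adicCompletion K') × (v.adicCompletion K') := ((↑C.u⁻¹ : (v.adicCompletion K')), C.r, C.s, C.t) with hp₀_def
  set S : Set ((v.adicCompletion K') × (v.adicCompletion K') × (v.adicCompletion K') × (v.adicCompletion K')) :=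
    {p | Valued.v p.1 = Valued.v (↑C.u⁻¹ : (v.adicCompletion K'))} ∩
      ({p | Valued.v (Xv.polyVariableChange p).a₁ ≤ exp (-(k₁ : ℤ))} ∩
      {p | Valued.v (Xv.polyVariableChange p).a₂ ≤ exp (-(k₂ : ℤ))} ∩
      {p | Valued.v (Xv.polyVariableChange p).a₃ ≤ exp (-(k₃ : ℤ))} ∩
      {p | N.a₃ = 0 ∨ Valued.v (Xv.polyVariableChange p).a₃ = Valued.v (N.a₃ : (v.adicCompletion K'))} ∩
      {p | Valued.v (Xv.polyVariableChange p).a₄ ≤ exp (-(k₄ : ℤ))} ∩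
      {p | Valued.v (Xv.polyVariableChange p).a₆ = exp (-(k₆ : ℤ))} ∩
      {p | Valued.v ((Xv.polyVariableChange p).a₆ - (c₆ : v.adicCompletion K')) ≤ exp (-(k₆' : ℤ))} ∩
      {p | Valued.v (Xv.polyVariableChange p).b₈ ≤ exp (-(k₈ : ℤ))} ∩
      {p | N.b₈ = 0 ∨ Valued.v (Xv.polyVariableChange p).b₈ = Valued.v (N.b₈ : (v.adicCompletion K'))}) with hS_def
  have hp₀ : C • Xv = Xv.polyVariableChange p₀ := variableChange_eq_polyVariableChange Xv C
  have hexact : ∀ {f : (v.adicCompletion K') × (v.adicCompletion K') × (v.adicCompletion K') × (v.adicCompletion K') → (v.adicCompletion K')} (_ : Continuous f) {k : ℕ}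
      (_ : Valued.v (f p₀) = exp (-(k : ℤ))), {p | Valued.v (f p) = exp (-(k : ℤ))} ∈ nhds p₀ := by
    intro f hf k hfk
    have hT := Valued.locally_const (x := f p₀) (by rw [hfk]; exact exp_ne_zero)
    have h := hf.continuousAt.preimage_mem_nhds hT
    simpa only [Set.preimage_setOf_eq, hfk] using h
  have hS : S ∈ nhds p₀ := by
    refine Filter.inter_mem ?_ (Filter.inter_mem (Filter.inter_mem (Filter.inter_mem (Filter.inter_mem
      (Filter.inter_mem (Filter.inter_mem (Filter.inter_mem (Filter.inter_mem ?_ ?_) ?_) ?_) ?_) ?_) ?_) ?_) ?_)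
    · exact continuous_fst.continuousAt.preimage_mem_nhds (Valued.locally_const hu0)
    · refine (Xv.continuous_polyVariableChange_a₁).continuousAt.preimage_mem_nhds
        (setOf_valued_le_exp_mem_nhds v _ ?_)
      rw [← hp₀]; exact hC₁
    · refine (Xv.continuous_polyVariableChange_a₂).continuousAt.preimage_mem_nhds
        (setOf_valued_le_exp_mem_nhds v _ ?_)
      rw [← hp₀]; exact hC₂
    · refine (Xv.continuous_polyVariableChange_a₃).continuousAt.preimage_mem_nhds
        (setOf_valued_le_exp_mem_nhds v _ ?_)
      rw [← hp₀]; exact hC₃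
    · by_cases hN0 : N.a₃ = 0
      · exact Filter.univ_mem' fun p ↦ Or.inl hN0
      · have ha₃0 : Valued.v (Xv.polyVariableChange p₀).a₃ = Valued.v (N.a₃ : (v.adicCompletion K')) := by
          rw [← hp₀, ← hNK, map_a₃]; rfl
        have hne : Valued.v (Xv.polyVariableChange p₀).a₃ ≠ 0 := by
          rw [ha₃0, Valuation.ne_zero_iff]
          exact_mod_cast hN0
        have hT := Valued.locally_const (x := (Xv.polyVariableChange p₀).a₃) hne
        have h := (Xv.continuous_polyVariableChange_a₃).continuousAt.preimage_mem_nhds hT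
        refine Filter.mem_of_superset h fun p hp ↦ Or.inr ?_
        simp only [Set.mem_preimage, Set.mem_setOf_eq] at hp
        rw [hp, ha₃0]
    · refine (Xv.continuous_polyVariableChange_a₄).continuousAt.preimage_mem_nhds
        (setOf_valued_le_exp_mem_nhds v _ ?_)
      rw [← hp₀]; exact hC₄
    · exact hexact (Xv.continuous_polyVariableChange_a₆) (by rw [← hp₀]; exact hC₆)
    · have hc6 : Continuous fun p : (v.adicCompletion K') × (v.adicCompletion K') × (v.adicCompletion K') ×
          (v.adicCompletion K') ↦ (Xv.polyVariableChange p).a₆ - (c₆ : v.adicCompletion K') :=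
        (Xv.continuous_polyVariableChange_a₆).sub continuous_const
      have h6c : {y : v.adicCompletion K' | Valued.v y ≤ exp (-(k₆' : ℤ))} ∈
          nhds ((Xv.polyVariableChange p₀).a₆ - (c₆ : v.adicCompletion K')) :=
        setOf_valued_le_exp_mem_nhds v _ (by rw [← hp₀]; exact hC₆c)
      exact hc6.continuousAt.preimage_mem_nhds h6c
    · refine hb₈c.continuousAt.preimage_mem_nhds (setOf_valued_le_exp_mem_nhds v _ ?_)
      rw [← hp₀]; exact hC₈
    · by_cases hN0 : N.b₈ = 0
      · exact Filter.univ_mem' fun p ↦ Or.inl hN0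
      · have hb₈0 : Valued.v (Xv.polyVariableChange p₀).b₈ = Valued.v (N.b₈ : (v.adicCompletion K')) := by
          rw [← hp₀, ← hNK, map_b₈]; rfl
        have hne : Valued.v (Xv.polyVariableChange p₀).b₈ ≠ 0 := by
          rw [hb₈0, Valuation.ne_zero_iff]
          exact_mod_cast hN0
        have hT := Valued.locally_const (x := (Xv.polyVariableChange p₀).b₈) hne
        have h := hb₈c.continuousAt.preimage_mem_nhds hT
        refine Filter.mem_of_superset h fun p hp ↦ Or.inr ?_
        simp only [Set.mem_preimage, Set.mem_setOf_eq] at hp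
        rw [hp, hb₈0]
  have hd : DenseRange φ := HeightOneSpectrum.denseRange_algebraMap K' v
  obtain ⟨⟨w', r', s', t'⟩, hwv, ⟨⟨⟨⟨⟨⟨⟨⟨h₁, h₂'⟩, h₃⟩, h₃'⟩, h₄⟩, h₆⟩, h₆c⟩, h₈⟩, h₈'⟩⟩ :=
    (hd.prodMap (hd.prodMap (hd.prodMap hd))).mem_nhds hS
  simp only [Prod.map_apply, Set.mem_setOf_eq] at hwv h₁ h₂' h₃ h₃' h₄ h₆ h₆c h₈ h₈'
  have hw' : w' ≠ 0 := by
    rintro rfl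
    rw [map_zero, Valuation.map_zero] at hwv
    exact hu0 hwv.symm
  set C' : VariableChange K' := ⟨(Units.mk0 w' hw')⁻¹, r', s', t'⟩ with hC'_def
  have hC'W : (C' • X).baseChange (v.adicCompletion K') = Xv.polyVariableChange (φ w', φ r', φ s', φ t') := by
    rw [variableChange_eq_polyVariableChange, baseChange, map_polyVariableChange]
    simp [C', hXv, hφ, baseChange]
  have hval : ∀ x : K', v.valuation K' x = Valued.v (φ x) := fun x ↦ by
    rw [hφ, valued_algebraMap_adicCompletion]
  have hb₈K : φ (C' • X).b₈ = ((C' • X).baseChange (v.adicCompletion K')).b₈ := by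
    simp only [baseChange, map_b₈]; rfl
  refine ⟨C', ?_, ?_, ?_, ?_, ?_, ?_, ?_, ?_, ?_, ?_⟩
  · rw [hval, show φ (C' • X).a₁ = ((C' • X).baseChange (v.adicCompletion K')).a₁ from rfl, hC'W]; exact h₁
  · rw [hval, show φ (C' • X).a₂ = ((C' • X).baseChange (v.adicCompletion K')).a₂ from rfl, hC'W]; exact h₂'
  · rw [hval, show φ (C' • X).a₃ = ((C' • X).baseChange (v.adicCompletion K')).a₃ from rfl, hC'W]; exact h₃
  · intro m w hw hmw
    have hN0 : N.a₃ ≠ 0 := by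
      rw [hmw]
      exact mul_ne_zero (pow_ne_zero _ h2irr.ne_zero) hw.ne_zero
    rw [hval, show φ (C' • X).a₃ = ((C' • X).baseChange (v.adicCompletion K')).a₃ from rfl, hC'W,
      h₃'.resolve_left hN0]
    exact heq hw hmw
  · rw [hval, show φ (C' • X).a₄ = ((C' • X).baseChange (v.adicCompletion K')).a₄ from rfl, hC'W]; exact h₄
  · rw [hval, show φ (C' • X).a₆ = ((C' • X).baseChange (v.adicCompletion K')).a₆ from rfl, hC'W]; exact h₆
  · rw [hval, map_sub, map_intCast,
      show φ (C' • X).a₆ = ((C' • X).baseChange (v.adicCompletion K')).a₆ from rfl, hC'W]; exact h₆c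
  · rw [hval, hb₈K, hC'W]; exact h₈
  · intro m w hw hmw
    have hN0 : N.b₈ ≠ 0 := by
      rw [hmw]
      exact mul_ne_zero (pow_ne_zero _ h2irr.ne_zero) hw.ne_zero
    rw [hval, hb₈K, hC'W, h₈'.resolve_left hN0]
    exact heq hw hmw
  · rw [hval, variableChange_Δ, inv_inv, Units.val_mk0, map_mul, map_pow, Valuation.map_mul,
      Valuation.map_pow, hwv, ← hCΔ, variableChange_Δ, Valuation.map_mul, Valuation.map_pow]
    simp only [hXv, baseChange, map_Δ]
    rfl

end Dedekind

end WeierstrassCurve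

end Transfer

/-! ## §3. Over `ℚ`: the `C₆`-branch of type `I₀*`, `ord₂ Δ_min = 8` -/

namespace WeierstrassCurve

open Literature.NumberTheory.EllipticCurves Literature.NumberTheory.GaloisRepresentations
  IsDedekindDomain.HeightOneSpectrum Rat.HeightOneSpectrum

variable (X : WeierstrassCurve ℚ)

/-- **The twist by `-1` of a `C₆`-curve of type `I₀*`, `ord₂ Δ = 8`, has the shape of type `IV*`.**
Let `X/ℚ` have `ord₂(a₁) ≥ 1`, `ord₂(a₂) ≥ 1`, `ord₂(a₃) = 2`, `ord₂(a₄) ≥ 3`, `ord₂(a₆) = 3`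
(the canonical normal form of type `I₀*` with `ord₂ Δ = 8`), `ord₂(Δ) = 8` and `ord₂(b₈) ≥ 6`.  Write
`a₁ = 2α`, `a₂ = 2P`, `a₃ = 4γ`, `a₄ = 4q` (`2 ∣ q`), `a₆ = 8r` (`γ, r` units);
`b₈ = 16(2α²r + 4Pr - 2αγq + 2Pγ² - q²)`, so `2⁶ ∣ b₈` gives `α² + P ≡ 0 (mod 2)`.  The twist
`X^{(-1)} : y² = x³ - (α² + 2P)x² + 4(q + αγ)x - 4(γ² + 2r)` under `y ↦ y + sx + 2`, with `s = 0` if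
`α` is even (then `P` is even) and `s = 1` if `α` is a unit (then `P + 1` is even), becomes
`a₁' = 2s`, `a₂' = -(α² + 2P) - s² ∈ 4ℤ₂`, `a₃' = 4`, `a₄' = 4(q + αγ - s) ∈ 8ℤ₂`,
`a₆' = -4((γ² - 1) + 2(r + 1)) ∈ 16ℤ₂`, `Δ' = Δ`: the shape `(ord aᵢ) ≥ (1, 2, 2, 3, 4)`, `ord Δ = 8`
of Kodaira type `IV*` (*ATAEC* IV.9.4 Step 8).
[cite: SilvermanATAEC1994, IV.9.4 Steps 6–8 and Table 4.1] [cite: SilvermanAEC2009, X.5 Cor. 5.4] -/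
theorem exists_variableChange_quadraticTwist_neg_one_of_Istar_zero_eight_of_valuation_b₈_le
    {v : HeightOneSpectrum (𝓞 ℚ)} (hv : (2 : 𝓞 ℚ) ∈ v.asIdeal)
    (h₁ : v.valuation ℚ X.a₁ ≤ exp (-1 : ℤ)) (h₂ : v.valuation ℚ X.a₂ ≤ exp (-1 : ℤ))
    (h₃ : v.valuation ℚ X.a₃ = exp (-2 : ℤ)) (h₄ : v.valuation ℚ X.a₄ ≤ exp (-3 : ℤ))
    (h₆ : v.valuation ℚ X.a₆ = exp (-3 : ℤ)) (h₈ : v.valuation ℚ X.b₈ ≤ exp (-6 : ℤ))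
    (hΔ : v.valuation ℚ X.Δ = exp (-8 : ℤ)) :
    ∃ C : VariableChange ℚ,
      v.valuation ℚ (C • X.quadraticTwist (-1)).a₁ ≤ exp (-(1 : ℕ) : ℤ) ∧
      v.valuation ℚ (C • X.quadraticTwist (-1)).a₂ ≤ exp (-(2 : ℕ) : ℤ) ∧
      v.valuation ℚ (C • X.quadraticTwist (-1)).a₃ ≤ exp (-(2 : ℕ) : ℤ) ∧
      v.valuation ℚ (C • X.quadraticTwist (-1)).a₄ ≤ exp (-(3 : ℕ) : ℤ) ∧
      v.valuation ℚ (C • X.quadraticTwist (-1)).a₆ ≤ exp (-(4 : ℕ) : ℤ) ∧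
      v.valuation ℚ (C • X.quadraticTwist (-1)).Δ = exp (-(8 : ℕ) : ℤ) := by
  have hv2 : natGenerator v = 2 := Rat.natGenerator_eq_two hv
  set Kv := v.adicCompletion ℚ with hKv
  set φ := algebraMap ℚ Kv with hφ
  have hval : ∀ x : ℚ, v.valuation ℚ x = Valued.v (φ x) := fun x ↦ by
    rw [hφ, valued_algebraMap_adicCompletion]
  have V2 : Valued.v (2 : Kv) = exp (-1 : ℤ) := valued_two v hv2
  have h20 : (2 : Kv) ≠ 0 := by
    intro h; rw [h, Valuation.map_zero] at V2; exact exp_ne_zero V2.symm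
  have h40 : (4 : Kv) ≠ 0 := by
    rw [show (4 : Kv) = 2 * 2 by norm_num]; exact mul_ne_zero h20 h20
  have h80 : (8 : Kv) ≠ 0 := by
    rw [show (8 : Kv) = 2 * 4 by norm_num]; exact mul_ne_zero h20 h40
  have V4 : Valued.v (4 : Kv) = exp (-2 : ℤ) := by
    rw [show (4 : Kv) = 2 ^ 2 by norm_num, Valuation.map_pow, V2, ← exp_nsmul]; norm_num
  have V8 : Valued.v (8 : Kv) = exp (-3 : ℤ) := by
    rw [show (8 : Kv) = 2 ^ 3 by norm_num, Valuation.map_pow, V2, ← exp_nsmul]; norm_num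
  -- `α = a₁/2, P = a₂/2, γ = a₃/4, q = a₄/4, r = a₆/8`
  set α : Kv := φ X.a₁ / 2 with hα
  set P : Kv := φ X.a₂ / 2 with hP
  set γ : Kv := φ X.a₃ / 4 with hγ
  set q : Kv := φ X.a₄ / 4 with hq
  set r : Kv := φ X.a₆ / 8 with hr
  have hdivle : ∀ {x : ℚ} {c : Kv} {g gc : WithZero (Multiplicative ℤ)}, c ≠ 0 → Valued.v c = gc →
      v.valuation ℚ x ≤ g * gc → Valued.v (φ x / c) ≤ g := by
    intro x c g gc hc hvc hx
    rw [map_div₀, hvc, div_le_iff₀ (zero_lt_iff.mpr (by rw [← hvc]; exact (Valuation.ne_zero_iff _).mpr hc)),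
      ← hval]; exact hx
  have hdiveq : ∀ {x : ℚ} {c : Kv} {g gc : WithZero (Multiplicative ℤ)}, c ≠ 0 → Valued.v c = gc →
      v.valuation ℚ x = g * gc → Valued.v (φ x / c) = g := by
    intro x c g gc hc hvc hx
    rw [map_div₀, hvc, div_eq_iff (by rw [← hvc]; exact (Valuation.ne_zero_iff _).mpr hc), ← hval]
    exact hx
  have hαv : Valued.v α ≤ 1 := hdivle h20 V2 (by rw [one_mul]; exact h₁)
  have hPv : Valued.v P ≤ 1 := hdivle h20 V2 (by rw [one_mul]; exact h₂)
  have hγv : Valued.v γ = 1 := hdiveq h40 V4 (by rw [one_mul]; exact h₃)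
  have hqv : Valued.v q ≤ exp (-1 : ℤ) :=
    hdivle h40 V4 (by rw [← exp_add]; exact h₄.trans (by norm_num))
  have hrv : Valued.v r = 1 := hdiveq h80 V8 (by rw [one_mul]; exact h₆)
  have ha₁ : φ X.a₁ = 2 * α := by rw [hα, mul_div_cancel₀ _ h20]
  have ha₂ : φ X.a₂ = 2 * P := by rw [hP, mul_div_cancel₀ _ h20]
  have ha₃ : φ X.a₃ = 4 * γ := by rw [hγ, mul_div_cancel₀ _ h40]
  have ha₄ : φ X.a₄ = 4 * q := by rw [hq, mul_div_cancel₀ _ h40]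
  have ha₆ : φ X.a₆ = 8 * r := by rw [hr, mul_div_cancel₀ _ h80]
  -- `2`-adic congruences
  have hunit : ∀ {x : Kv}, Valued.v x = 1 → Valued.v (x - 1) ≤ exp (-1 : ℤ) := fun {x} hx ↦
    valued_le_exp_neg_one_of_lt_one v
      ((valued_lt_one_or_valued_sub_one_lt_one v hv2 hx.le).resolve_left (by rw [hx]; exact lt_irrefl 1))
  have hγsq : Valued.v (γ ^ 2 - 1) ≤ exp (-3 : ℤ) := valued_sq_sub_one_le_of_valued_eq_one v hv2 hγv
  have hαsq : Valued.v α = 1 → Valued.v (α ^ 2 - 1) ≤ exp (-3 : ℤ) := fun h ↦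
    valued_sq_sub_one_le_of_valued_eq_one v hv2 h
  have hr1 : Valued.v (r + 1) ≤ exp (-1 : ℤ) := by
    have := hunit hrv
    have e : r + 1 = (r - 1) + 2 := by ring
    rw [e]; exact Valuation.map_add_le _ this V2.le
  -- `α² + P ∈ 2𝓞` from `2⁶ ∣ b₈ = 16(2α²r + 4Pr - 2αγq + 2Pγ² - q²)`
  have hb₈ : φ X.b₈ = 2 ^ 5 * (α ^ 2 * r + 2 * P * r - α * γ * q + P * γ ^ 2) - (4 * q) ^ 2 := by
    have : φ X.b₈ = (φ X.a₁) ^ 2 * φ X.a₆ + 4 * φ X.a₂ * φ X.a₆ - φ X.a₁ * φ X.a₃ * φ X.a₄ +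
        φ X.a₂ * (φ X.a₃) ^ 2 - (φ X.a₄) ^ 2 := by
      simp only [WeierstrassCurve.b₈, map_add, map_sub, map_mul, map_pow, map_ofNat]
    rw [this, ha₁, ha₂, ha₃, ha₄, ha₆]; ring
  have hin : Valued.v (α ^ 2 * r + 2 * P * r - α * γ * q + P * γ ^ 2) ≤ exp (-1 : ℤ) := by
    have e : α ^ 2 * r + 2 * P * r - α * γ * q + P * γ ^ 2 = (φ X.b₈ + (4 * q) ^ 2) / 2 ^ 5 := by
      rw [hb₈, sub_add_cancel, mul_div_cancel_left₀ _ (pow_ne_zero 5 h20)]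
    rw [e, map_div₀, Valuation.map_pow, V2, div_le_iff₀ (pow_pos (zero_lt_iff.mpr exp_ne_zero) 5),
      ← exp_nsmul, ← exp_add]
    refine Valuation.map_add_le _ ((hval _).symm.le.trans (h₈.trans (by norm_num))) ?_
    rw [Valuation.map_pow, Valuation.map_mul, V4]
    calc (exp (-2 : ℤ) * Valued.v q) ^ 2 ≤ (exp (-2 : ℤ) * exp (-1 : ℤ)) ^ 2 :=
          pow_le_pow_left' (mul_le_mul' le_rfl hqv) 2
      _ ≤ _ := by rw [← exp_add, ← exp_nsmul]; norm_num
  have hαP : Valued.v (α ^ 2 + P) ≤ exp (-1 : ℤ) := by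
    have e : α ^ 2 + P = (α ^ 2 * r + 2 * P * r - α * γ * q + P * γ ^ 2) - α ^ 2 * (r - 1)
        - 2 * P * r + α * γ * q - P * (γ ^ 2 - 1) := by ring
    rw [e]
    refine Valuation.map_sub_le _ (Valuation.map_add_le _ (Valuation.map_sub_le _
      (Valuation.map_sub_le _ hin ?_) ?_) ?_) ?_
    · rw [Valuation.map_mul, Valuation.map_pow]
      exact (mul_le_mul' (pow_le_one' hαv 2) (hunit hrv)).trans (by rw [one_mul])
    · rw [Valuation.map_mul, Valuation.map_mul, V2, hrv, mul_one]
      exact (mul_le_mul' le_rfl hPv).trans (by rw [mul_one])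
    · rw [Valuation.map_mul, Valuation.map_mul, hγv, mul_one]
      exact (mul_le_mul' hαv hqv).trans (by rw [one_mul])
    · rw [Valuation.map_mul]
      exact (mul_le_mul' hPv hγsq).trans (by rw [one_mul, exp_le_exp]; norm_num)
  -- the coefficients of `X⁻ = X.quadraticTwist (-1)`
  set Xm := X.quadraticTwist (-1) with hXm
  have hA₁ : Xm.a₁ = 0 := rfl
  have hA₃ : Xm.a₃ = 0 := rfl
  have hA₂ : φ Xm.a₂ = -(α ^ 2 + 2 * P) := by
    rw [hXm, quadraticTwist_a₂, WeierstrassCurve.b₂]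
    simp only [map_div₀, map_mul, map_add, map_pow, map_neg, map_one, map_ofNat]
    rw [ha₁, ha₂, div_eq_iff h40]
    ring
  have hA₄ : φ Xm.a₄ = 4 * (q + α * γ) := by
    rw [hXm, quadraticTwist_a₄, WeierstrassCurve.b₄]
    simp only [map_div₀, map_mul, map_add, map_pow, map_neg, map_one, map_ofNat]
    rw [ha₁, ha₃, ha₄, div_eq_iff h20]
    ring
  have hA₆ : φ Xm.a₆ = -(4 * (γ ^ 2 + 2 * r)) := by
    rw [hXm, quadraticTwist_a₆, WeierstrassCurve.b₆]
    simp only [map_div₀, map_mul, map_add, map_pow, map_neg, map_one, map_ofNat]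
    rw [ha₃, ha₆, div_eq_iff h40]
    ring
  have hΔm : Xm.Δ = X.Δ := by rw [hXm, quadraticTwist_Δ]; norm_num
  -- `A₆ - 4 ∈ 16𝓞`
  have hY₆ : Valued.v (φ Xm.a₆ - 4) ≤ exp (-4 : ℤ) := by
    rw [hA₆]
    have e : -(4 * (γ ^ 2 + 2 * r)) - 4 = -(4 * ((γ ^ 2 - 1) + 2 * (r + 1))) := by ring
    rw [e, Valuation.map_neg, Valuation.map_mul, V4, show exp (-4 : ℤ) = exp (-2 : ℤ) * exp (-2 : ℤ) by
      rw [← exp_add]; norm_num]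
    refine mul_le_mul' le_rfl (Valuation.map_add_le _ (hγsq.trans (by rw [exp_le_exp]; norm_num)) ?_)
    rw [Valuation.map_mul, V2]
    exact (mul_le_mul' le_rfl hr1).trans (by rw [← exp_add]; norm_num)
  -- the coefficients of `⟨1, 0, s, 2⟩ • X⁻`
  have e0₁ : ((⟨1, 0, 0, 2⟩ : VariableChange ℚ) • Xm).a₁ = 0 := by
    rw [variableChange_a₁, hA₁]; simp
  have e0₂ : ((⟨1, 0, 0, 2⟩ : VariableChange ℚ) • Xm).a₂ = Xm.a₂ := by
    rw [variableChange_a₂, hA₁]; simp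
  have e0₃ : ((⟨1, 0, 0, 2⟩ : VariableChange ℚ) • Xm).a₃ = 4 := by
    rw [variableChange_a₃, hA₁, hA₃]; norm_num
  have e0₄ : ((⟨1, 0, 0, 2⟩ : VariableChange ℚ) • Xm).a₄ = Xm.a₄ := by
    rw [variableChange_a₄, hA₁, hA₃]; simp
  have e0₆ : ((⟨1, 0, 0, 2⟩ : VariableChange ℚ) • Xm).a₆ = Xm.a₆ - 4 := by
    rw [variableChange_a₆, hA₁, hA₃]; norm_num
  have e0Δ : ((⟨1, 0, 0, 2⟩ : VariableChange ℚ) • Xm).Δ = X.Δ := by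
    rw [variableChange_Δ, hΔm]; simp
  have e1₁ : ((⟨1, 0, 1, 2⟩ : VariableChange ℚ) • Xm).a₁ = 2 := by
    rw [variableChange_a₁, hA₁]; simp
  have e1₂ : ((⟨1, 0, 1, 2⟩ : VariableChange ℚ) • Xm).a₂ = Xm.a₂ - 1 := by
    rw [variableChange_a₂, hA₁]; simp
  have e1₃ : ((⟨1, 0, 1, 2⟩ : VariableChange ℚ) • Xm).a₃ = 4 := by
    rw [variableChange_a₃, hA₁, hA₃]; norm_num
  have e1₄ : ((⟨1, 0, 1, 2⟩ : VariableChange ℚ) • Xm).a₄ = Xm.a₄ - 4 := by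
    rw [variableChange_a₄, hA₁, hA₃]; norm_num
  have e1₆ : ((⟨1, 0, 1, 2⟩ : VariableChange ℚ) • Xm).a₆ = Xm.a₆ - 4 := by
    rw [variableChange_a₆, hA₁, hA₃]; norm_num
  have e1Δ : ((⟨1, 0, 1, 2⟩ : VariableChange ℚ) • Xm).Δ = X.Δ := by
    rw [variableChange_Δ, hΔm]; simp
  have hφ2 : Valued.v (φ 2) = exp (-1 : ℤ) := by rw [map_ofNat, V2]
  have hφ4 : Valued.v (φ 4) = exp (-2 : ℤ) := by rw [map_ofNat, V4]
  have hthree : exp (-3 : ℤ) = exp (-2 : ℤ) * exp (-1 : ℤ) := by rw [← exp_add]; norm_num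
  by_cases hpar : Valued.v α < 1
  · -- `s = 0`: `α ∈ 2𝓞`, hence `P ∈ 2𝓞`
    have hα1 : Valued.v α ≤ exp (-1 : ℤ) := valued_le_exp_neg_one_of_lt_one v hpar
    have hP1 : Valued.v P ≤ exp (-1 : ℤ) := by
      have e : P = (α ^ 2 + P) - α ^ 2 := by ring
      rw [e]
      refine Valuation.map_sub_le _ hαP ?_
      rw [Valuation.map_pow]
      exact (pow_le_pow_left' hα1 2).trans (by rw [← exp_nsmul, exp_le_exp]; norm_num)
    refine ⟨⟨1, 0, 0, 2⟩, ?_, ?_, ?_, ?_, ?_, ?_⟩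
    · rw [e0₁, Valuation.map_zero]; exact zero_le
    · rw [e0₂, hval, hA₂, Valuation.map_neg, Nat.cast_ofNat,
        show exp (-2 : ℤ) = exp (-1 : ℤ) * exp (-1 : ℤ) by rw [← exp_add]; norm_num]
      refine Valuation.map_add_le _ ?_ ?_
      · rw [Valuation.map_pow, pow_two]; exact mul_le_mul' hα1 hα1
      · rw [Valuation.map_mul, V2]; exact mul_le_mul' le_rfl hP1
    · rw [e0₃, hval, hφ4]; simp
    · rw [e0₄, hval, hA₄, Valuation.map_mul, V4, Nat.cast_ofNat, hthree]
      refine mul_le_mul' le_rfl (Valuation.map_add_le _ hqv ?_)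
      rw [Valuation.map_mul, hγv, mul_one]; exact hα1
    · rw [e0₆, hval, map_sub, map_ofNat]; exact hY₆
    · rw [e0Δ]; simpa using hΔ
  · -- `s = 1`: `α` is a unit, hence `P + 1 ∈ 2𝓞`
    have hα1 : Valued.v α = 1 := le_antisymm hαv (not_lt.mp hpar)
    have hP1 : Valued.v (P + 1) ≤ exp (-1 : ℤ) := by
      have e : P + 1 = (α ^ 2 + P) - (α ^ 2 - 1) := by ring
      rw [e]
      exact Valuation.map_sub_le _ hαP ((hαsq hα1).trans (by rw [exp_le_exp]; norm_num))
    refine ⟨⟨1, 0, 1, 2⟩, ?_, ?_, ?_, ?_, ?_, ?_⟩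
    · rw [e1₁, hval, hφ2]; simp
    · rw [e1₂, hval, map_sub, map_one, hA₂, Nat.cast_ofNat]
      have e : -(α ^ 2 + 2 * P) - 1 = -((α ^ 2 - 1) + 2 * (P + 1)) := by ring
      rw [e, Valuation.map_neg]
      refine Valuation.map_add_le _ ((hαsq hα1).trans (by rw [exp_le_exp]; norm_num)) ?_
      rw [Valuation.map_mul, V2, show exp (-2 : ℤ) = exp (-1 : ℤ) * exp (-1 : ℤ) by
        rw [← exp_add]; norm_num]
      exact mul_le_mul' le_rfl hP1
    · rw [e1₃, hval, hφ4]; simp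
    · rw [e1₄, hval, map_sub, map_ofNat, hA₄, Nat.cast_ofNat]
      have e : 4 * (q + α * γ) - 4 = 4 * (q + (α * γ - 1)) := by ring
      rw [e, Valuation.map_mul, V4, hthree]
      refine mul_le_mul' le_rfl (Valuation.map_add_le _ hqv (hunit ?_))
      rw [Valuation.map_mul, hα1, hγv, mul_one]
    · rw [e1₆, hval, map_sub, map_ofNat]; exact hY₆
    · rw [e1Δ]; simpa using hΔ

end WeierstrassCurve

namespace WeierstrassCurve

open Literature.NumberTheory.EllipticCurves Literature.NumberTheory.GaloisRepresentations
  Literature.NumberTheory.DiophantineGeometry Literature.NumberTheory.DiophantineGeometry.TateAlgorithm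
  IsDedekindDomain.HeightOneSpectrum

variable (W : WeierstrassCurve ℚ)

/-- **`δ_v = ord_v(Δ_min) - 6` for Kodaira type `I₀*`** (`f_v = ord_v Δ_min + 1 - m_v` by the tree's
definition of the conductor exponent through Ogg's formula, `m_v = 5`, `ε_v = 2`); natural-number
subtraction, no hypothesis on `v`.  Silverman, *ATAEC*, Table 4.1 and IV.11.1.
[cite: SilvermanATAEC1994, IV.9 Table 4.1 and Thm. IV.11.1] -/
theorem wildConductorExponent_eq_of_kodairaSymbolAt_Istar_zero {A : Type*} [CommRing A]
    [IsDedekindDomain A] {K' : Type*} [Field K'] [Algebra A K'] [IsFractionRing A K']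
    (v : HeightOneSpectrum A) (X : WeierstrassCurve K') (hT : X.kodairaSymbolAt v = .Istar 0) :
    X.wildConductorExponent v = X.ordMinimalDiscriminant v - 6 := by
  unfold wildConductorExponent conductorExponent numComponentsAt
  rw [hT]
  simp only [KodairaSymbol.numComponents, KodairaSymbol.tameConductorExponent]
  omega

/-- **Type `I₀*` with `ord₂ Δ_min = 8` over `ℚ`: a `ℚ`-model with `ord₂(a₁) ≥ 1`, `ord₂(a₂) ≥ 1`,
`ord₂(a₃) = 2`, `ord₂(a₄) ≥ 3`, `ord₂(a₆) = 3`, `ord₂(Δ) = 8` and the dichotomy `ord₂(b₈) ≥ 6`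
(`Φ = C₆`) or `ord₂(b₈) = 5`** (the canonical normal form of
`exists_smul_a_of_kodairaSymbolOfMinimal_eq_Istar_zero_of_two_of_addVal_eq_eight` made `ℚ`-rational
by `exists_variableChange_valuation_a_b₈_of_two`). [cite: SilvermanATAEC1994, IV.9.4 Step 6 and Table 4.1] -/
theorem exists_variableChange_of_kodairaSymbolAt_Istar_zero_of_ordMinimalDiscriminant_eq_eight
    [W.IsElliptic] {v : HeightOneSpectrum (𝓞 ℚ)} (hv : (2 : 𝓞 ℚ) ∈ v.asIdeal)
    (hT : W.kodairaSymbolAt v = .Istar 0) (hord : W.ordMinimalDiscriminant v = 8) :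
    ∃ C : VariableChange ℚ,
      v.valuation ℚ (C • W).a₁ ≤ exp (-1 : ℤ) ∧ v.valuation ℚ (C • W).a₂ ≤ exp (-1 : ℤ) ∧
      v.valuation ℚ (C • W).a₃ = exp (-2 : ℤ) ∧ v.valuation ℚ (C • W).a₄ ≤ exp (-3 : ℤ) ∧
      v.valuation ℚ (C • W).a₆ = exp (-3 : ℤ) ∧ v.valuation ℚ (C • W).Δ = exp (-8 : ℤ) ∧
      (v.valuation ℚ (C • W).b₈ ≤ exp (-6 : ℤ) ∨ v.valuation ℚ (C • W).b₈ = exp (-5 : ℤ)) := by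
  have h2 := Rat.valuation_two_of_two_mem hv
  have h2irr := irreducible_two_adicCompletionIntegers v h2
  have hT' := hT
  rw [kodairaSymbolAt_def] at hT'
  have hΔ8 : (IsDiscreteValuationRing.addVal (v.adicCompletionIntegers ℚ)
      (W.localMinimalIntegralModel v).Δ).toNat = 8 := by
    rw [← hord, ordMinimalDiscriminant]
  obtain ⟨D, ha₁, ha₂, ⟨γ, hγ, ha₃⟩, ha₄, ⟨r, hr, ha₆⟩, hb₈, hΔ⟩ :=
    LocalIndex.exists_smul_a_of_kodairaSymbolOfMinimal_eq_Istar_zero_of_two_of_addVal_eq_eight h2irr _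
      hT' hΔ8
  have hb₈5 : (2 : v.adicCompletionIntegers ℚ) ^ 5 ∣ (D • W.localMinimalIntegralModel v).b₈ := by
    rcases hb₈ with ⟨w, hw⟩ | ⟨w, -, hw⟩
    · exact ⟨2 * w, by rw [hw]; ring⟩
    · exact ⟨w, hw⟩
  rcases hb₈ with hb₈ | ⟨w, hw, hb₈⟩
  · obtain ⟨-, C, h₁, h₂', h₃, h₄, h₆, h₈, -, hΔ'⟩ := W.exists_variableChange_valuation_a_b₈_of_two v h2
      (k₁ := 1) (k₂ := 1) (k₃ := 2) (k₄ := 3) (k₆ := 3) (k₈ := 6) (n := 8) D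
      (by simpa using ha₁) (by simpa using ha₂) ⟨γ, hγ, ha₃⟩ ha₄ ⟨r, hr, ha₆⟩ hb₈ hΔ
    exact ⟨C, by simpa using h₁, by simpa using h₂', by simpa using h₃, by simpa using h₄,
      by simpa using h₆, by simpa using hΔ', Or.inl (by simpa using h₈)⟩
  · obtain ⟨-, C, h₁, h₂', h₃, h₄, h₆, -, h₈, hΔ'⟩ := W.exists_variableChange_valuation_a_b₈_of_two v h2
      (k₁ := 1) (k₂ := 1) (k₃ := 2) (k₄ := 3) (k₆ := 3) (k₈ := 5) (n := 8) D
      (by simpa using ha₁) (by simpa using ha₂) ⟨γ, hγ, ha₃⟩ ha₄ ⟨r, hr, ha₆⟩ hb₈5 hΔ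
    exact ⟨C, by simpa using h₁, by simpa using h₂', by simpa using h₃, by simpa using h₄,
      by simpa using h₆, by simpa using hΔ', Or.inr (by simpa using h₈ hw hb₈)⟩

/-- **The twist by `-1` of a `C₆`-curve of type `I₀*`, `ord₂ Δ_min = 8`, is potentially good over
`ℚ(∛2)`**: with a `ℚ`-model `C • W` as in
`exists_variableChange_quadraticTwist_neg_one_of_Istar_zero_eight_of_valuation_b₈_le`
(`ord₂(b₈) ≥ 6`), `W^{(-1)}` has good reduction at the places above `v` of every number field
`L ∋ β`, `β³ = 2` (the type-`IV*` shape, `j = 2` in `hasGoodReductionAt_baseChange_of_pow_three_eq`).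
[cite: SilvermanATAEC1994, IV.9.4 Steps 6–8; proof of Thm. IV.10.2(b) (PDF pp. 359–361)]
[cite: SilvermanAEC2009, VII.5 Prop. 5.4, X.5 Cor. 5.4] -/
theorem hasGoodReductionAt_baseChange_quadraticTwist_neg_one_of_Istar_zero_eight_of_valuation_b₈_le
    {v : HeightOneSpectrum (𝓞 ℚ)} (hv : (2 : 𝓞 ℚ) ∈ v.asIdeal) (C : VariableChange ℚ)
    (h₁ : v.valuation ℚ (C • W).a₁ ≤ exp (-1 : ℤ)) (h₂ : v.valuation ℚ (C • W).a₂ ≤ exp (-1 : ℤ))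
    (h₃ : v.valuation ℚ (C • W).a₃ = exp (-2 : ℤ)) (h₄ : v.valuation ℚ (C • W).a₄ ≤ exp (-3 : ℤ))
    (h₆ : v.valuation ℚ (C • W).a₆ = exp (-3 : ℤ)) (h₈ : v.valuation ℚ (C • W).b₈ ≤ exp (-6 : ℤ))
    (hΔ : v.valuation ℚ (C • W).Δ = exp (-8 : ℤ))
    (L : Type*) [Field L] [NumberField L] [Algebra ℚ L] {β : L} (hβ : β ^ 3 = 2)
    {w : HeightOneSpectrum (𝓞 L)} (hw : w.asIdeal.under (𝓞 ℚ) = v.asIdeal) :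
    ((W.quadraticTwist (-1)).baseChange L).HasGoodReductionAt w := by
  obtain ⟨C', g₁, g₂, g₃, g₄, g₆, gΔ⟩ :=
    (C • W).exists_variableChange_quadraticTwist_neg_one_of_Istar_zero_eight_of_valuation_b₈_le hv h₁
      h₂ h₃ h₄ h₆ h₈ hΔ
  have htw : (C • W).quadraticTwist (-1) =
      (⟨C.u, (-1) * C.r, 0, 0⟩ : VariableChange ℚ) • W.quadraticTwist (-1) :=
    quadraticTwist_smul W C (-1)
  rw [htw, ← mul_smul] at g₁ g₂ g₃ g₄ g₆ gΔ
  have hβ' : β ^ 3 = algebraMap ℚ L 2 := by rw [hβ, map_ofNat]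
  exact (W.quadraticTwist (-1)).hasGoodReductionAt_baseChange_of_pow_three_eq L
    (Rat.valuation_two_of_two_mem hv) hβ' 2 _ g₁ g₂ g₃ g₄ g₆ gΔ
    (by norm_num) (by norm_num) (by norm_num) (by norm_num) (by norm_num) (by norm_num) hw

variable (ℓ : ℕ) [Fact ℓ.Prime]

/-- **`Sw_𝔓(V_ℓ E) = 2` for the `C₆`-curves of type `I₀*`, `ord₂ Δ_min = 8`** (`ℓ ≠ 2`, `𝔓 ∣ 2`):
`E^{(-1)}` is potentially good over `ℚ(∛2)`, and the break of `ℚ₂(√-1)` is `1`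
(`swanConductorAt_rationalTate_eq_two_of_quadraticTwist_of_emod_four_eq_three`).  Silverman,
*ATAEC* IV.9 Table 4.1 (type `I₀*`, `f = 4`, `ord₂ Δ = 8`) with Thm. IV.10.2(b).
[cite: SilvermanATAEC1994, IV.9 Table 4.1, Thm. IV.10.2(b) (PDF pp. 358–361)] [cite: SerreTate1968, §3] -/
theorem swanConductorAt_rationalTate_eq_two_of_Istar_zero_eight_of_valuation_b₈_le [W.IsElliptic]
    (h : Continuous fun x : absoluteGaloisGroup ℚ × RationalTateModule (geomPoints W) ℓ ↦
      rationalTateRepresentation (absoluteGaloisGroup ℚ) (geomPoints W) ℓ x.1 x.2)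
    {v : HeightOneSpectrum (𝓞 ℚ)} (hv : (2 : 𝓞 ℚ) ∈ v.asIdeal) (hℓ : (ℓ : 𝓞 ℚ) ∉ v.asIdeal)
    (C : VariableChange ℚ)
    (h₁ : v.valuation ℚ (C • W).a₁ ≤ exp (-1 : ℤ)) (h₂ : v.valuation ℚ (C • W).a₂ ≤ exp (-1 : ℤ))
    (h₃ : v.valuation ℚ (C • W).a₃ = exp (-2 : ℤ)) (h₄ : v.valuation ℚ (C • W).a₄ ≤ exp (-3 : ℤ))
    (h₆ : v.valuation ℚ (C • W).a₆ = exp (-3 : ℤ)) (h₈ : v.valuation ℚ (C • W).b₈ ≤ exp (-6 : ℤ))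
    (hΔ : v.valuation ℚ (C • W).Δ = exp (-8 : ℤ))
    {𝔓 : Ideal (absIntegers (𝓞 ℚ) ℚ)} (h𝔓 : 𝔓 ∈ v.primesAbove) :
    (rationalTateGaloisRepOf (geomPoints W) ℓ h).swanConductorAt (𝓞 ℚ) 𝔓 = 2 :=
  W.swanConductorAt_rationalTate_eq_two_of_quadraticTwist_of_emod_four_eq_three ℓ h hv hℓ
    (d := -1) (by decide)
    (fun L _ _ _ β hβ w hw ↦ by
      have := W.hasGoodReductionAt_baseChange_quadraticTwist_neg_one_of_Istar_zero_eight_of_valuation_b₈_le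
        hv C h₁ h₂ h₃ h₄ h₆ h₈ hΔ L hβ hw
      simpa using this)
    h𝔓

attribute [local instance] AddSubgroup.torsionBy.zmodModule in
/-- **Ogg's formula at `2` for the `C₆`-curves of type `I₀*`, `ord₂ Δ_min = 8`, `3`-torsion form**
(the shape of the hypothesis `H` of `conductorNatOf_geomPoints_eq_conductorNorm_of_isElliptic_of_potentiallyGood`
and its siblings): `Sw_𝔓(E[3]) = δ₂(E)`, both sides being `2` (`Sw_𝔓(V₃ E) = Sw_𝔓(E[3])`,
`swanConductorAt_rationalTate_eq_swanConductorAt_torsion`; `δ₂ = ord₂ Δ_min - 6`,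
`wildConductorExponent_eq_of_kodairaSymbolAt_Istar_zero`).
[cite: SilvermanATAEC1994, §IV.10 Definition of δ(E/K) (PDF p. 358), Thm. IV.11.1 (pp. 365–366), Table 4.1]
[cite: Saito1988, Theorem 1] -/
theorem swanConductorAt_torsion_eq_wildConductorExponent_of_Istar_zero_eight_of_valuation_b₈_le
    [W.IsElliptic] {v : HeightOneSpectrum (𝓞 ℚ)} (hv : (2 : 𝓞 ℚ) ∈ v.asIdeal)
    (hT : W.kodairaSymbolAt v = .Istar 0) (hord : W.ordMinimalDiscriminant v = 8) (C : VariableChange ℚ)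
    (h₁ : v.valuation ℚ (C • W).a₁ ≤ exp (-1 : ℤ)) (h₂ : v.valuation ℚ (C • W).a₂ ≤ exp (-1 : ℤ))
    (h₃ : v.valuation ℚ (C • W).a₃ = exp (-2 : ℤ)) (h₄ : v.valuation ℚ (C • W).a₄ ≤ exp (-3 : ℤ))
    (h₆ : v.valuation ℚ (C • W).a₆ = exp (-3 : ℤ)) (h₈ : v.valuation ℚ (C • W).b₈ ≤ exp (-6 : ℤ))
    (hΔ : v.valuation ℚ (C • W).Δ = exp (-8 : ℤ))
    {𝔓 : Ideal (absIntegers (𝓞 ℚ) ℚ)} (h𝔓 : 𝔓 ∈ v.primesAbove) :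
    (W.torsionGaloisRep 3).swanConductorAt (𝓞 ℚ) 𝔓 = (W.wildConductorExponent v : ℝ) := by
  haveI : Fact (Nat.Prime 3) := ⟨Nat.prime_three⟩
  have h3 : ((3 : ℕ) : 𝓞 ℚ) ∉ v.asIdeal := by
    intro h3
    apply (Ideal.ne_top_iff_one v.asIdeal).mp v.isPrime.ne_top
    have := v.asIdeal.sub_mem h3 hv
    rwa [show ((3 : ℕ) : 𝓞 ℚ) - 2 = 1 by norm_num] at this
  rw [← W.swanConductorAt_rationalTate_eq_swanConductorAt_torsion 3
    (W.continuous_rationalGaloisRepTate_holds 3) h3 h𝔓,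
    W.swanConductorAt_rationalTate_eq_two_of_Istar_zero_eight_of_valuation_b₈_le 3 _ hv h3 C h₁ h₂ h₃
      h₄ h₆ h₈ hΔ h𝔓,
    W.wildConductorExponent_eq_of_kodairaSymbolAt_Istar_zero v hT, hord]
  norm_num

end WeierstrassCurve


/-! ## §4. Over `ℚ`: the `C₆`-branch of type `I₀*`, `ord₂ Δ_min = 10` -/

namespace WeierstrassCurve

open Literature.NumberTheory.EllipticCurves Literature.NumberTheory.GaloisRepresentations
  IsDedekindDomain.HeightOneSpectrum Rat.HeightOneSpectrum

variable (X : WeierstrassCurve ℚ)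

/-- **The twist by `2ε` of a `C₆`-curve of type `I₀*`, `ord₂ Δ = 10`, with `a₆ ≡ 8ε (mod 32)`, has
the shape of type `IV` after rescaling.**  Let `X/ℚ` have `ord₂(a₁) ≥ 2`, `ord₂(a₂) ≥ 1`,
`ord₂(a₃) ≥ 5`, `ord₂(a₄) ≥ 3`, `ord₂(a₆) = 3`, `ord₂(a₆ - 8ε) ≥ 5` (`ε = ±1`), `ord₂(b₈) ≥ 7` and
`ord₂(Δ) = 10`.  Write `a₁ = 4α₁`, `a₂ = 2P`, `a₄ = 8q`, `a₆ = 8r` (`r ≡ ε (mod 4)`), `θ = a₃`;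
`b₈ = 2⁷α₁²r + 2⁶(Pr - q²) - 2⁵α₁θq + 2Pθ²`, so `2⁷ ∣ b₈` gives `P ≡ q (mod 2)`.  The twist `X^{(2ε)}`
has `a₂ = 4ε(2α₁² + P)`, `a₄ = 32q + 8α₁θ`, `a₆ = 64εr + 2εθ²`, `Δ = 2⁶Δ(X)`, and under
`(u; r, s, t) = (2; 0, 2s₀, 8)` with `s₀` the parity of `P` it becomes `a₁' = s₀·1`… precisely
`a₁' = s₀`, `a₂' = ε(2α₁² + P) - s₀²`, `a₃' = 2`, `a₄' = 2(q - s₀) + α₁θ/2`, `a₆' = ε(r - ε) + εθ²/32`,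
`Δ' = Δ/2⁶`: the shape `(ord aᵢ) ≥ (0 + [s₀ ∈ {0,1}], 1, 1, 2, 2)`, `ord Δ = 4` of Kodaira type `IV`.
[cite: SilvermanATAEC1994, IV.9.4 Steps 5–6 and Table 4.1] [cite: SilvermanAEC2009, X.5 Cor. 5.4] -/
theorem exists_variableChange_quadraticTwist_two_mul_of_Istar_zero_ten_of_valuation_b₈_le
    {v : HeightOneSpectrum (𝓞 ℚ)} (hv : (2 : 𝓞 ℚ) ∈ v.asIdeal) {ε : ℤ} (hε : ε = 1 ∨ ε = -1)
    (h₁ : v.valuation ℚ X.a₁ ≤ exp (-2 : ℤ)) (h₂ : v.valuation ℚ X.a₂ ≤ exp (-1 : ℤ))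
    (h₃ : v.valuation ℚ X.a₃ ≤ exp (-5 : ℤ)) (h₄ : v.valuation ℚ X.a₄ ≤ exp (-3 : ℤ))
    (h₆ : v.valuation ℚ X.a₆ = exp (-3 : ℤ)) (h₆ε : v.valuation ℚ (X.a₆ - 8 * ε) ≤ exp (-5 : ℤ))
    (h₈ : v.valuation ℚ X.b₈ ≤ exp (-7 : ℤ)) (hΔ : v.valuation ℚ X.Δ = exp (-10 : ℤ)) :
    ∃ C : VariableChange ℚ,
      v.valuation ℚ (C • X.quadraticTwist (2 * ε)).a₁ ≤ exp (-(1 : ℕ) : ℤ) ∧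
      v.valuation ℚ (C • X.quadraticTwist (2 * ε)).a₂ ≤ exp (-(1 : ℕ) : ℤ) ∧
      v.valuation ℚ (C • X.quadraticTwist (2 * ε)).a₃ ≤ exp (-(1 : ℕ) : ℤ) ∧
      v.valuation ℚ (C • X.quadraticTwist (2 * ε)).a₄ ≤ exp (-(2 : ℕ) : ℤ) ∧
      v.valuation ℚ (C • X.quadraticTwist (2 * ε)).a₆ ≤ exp (-(2 : ℕ) : ℤ) ∧
      v.valuation ℚ (C • X.quadraticTwist (2 * ε)).Δ = exp (-(4 : ℕ) : ℤ) := by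
  have hv2 : natGenerator v = 2 := Rat.natGenerator_eq_two hv
  set Kv := v.adicCompletion ℚ with hKv
  set φ := algebraMap ℚ Kv with hφ
  have hval : ∀ x : ℚ, v.valuation ℚ x = Valued.v (φ x) := fun x ↦ by
    rw [hφ, valued_algebraMap_adicCompletion]
  have V2 : Valued.v (2 : Kv) = exp (-1 : ℤ) := valued_two v hv2
  have h20 : (2 : Kv) ≠ 0 := by
    intro h; rw [h, Valuation.map_zero] at V2; exact exp_ne_zero V2.symm
  have hpow : ∀ n : ℕ, Valued.v ((2 : Kv) ^ n) = exp (-(n : ℤ)) := fun n ↦ by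
    rw [Valuation.map_pow, V2, ← exp_nsmul]; simp
  have hpow0 : ∀ n : ℕ, ((2 : Kv) ^ n) ≠ 0 := fun n ↦ pow_ne_zero n h20
  have hexp : ∀ {a b : ℤ}, a ≤ b → exp a ≤ exp b := fun h ↦ exp_le_exp.mpr h
  -- `V(x) ≤ g` from `V(2ⁿ x) ≤ 2⁻ⁿ g`, and from `v(y) ≤ 2⁻ⁿ g` for `φ y = 2ⁿ x`
  have hscale : ∀ {x : Kv} (n : ℕ) {g : WithZero (Multiplicative ℤ)},
      Valued.v (2 ^ n * x) ≤ exp (-(n : ℤ)) * g → Valued.v x ≤ g := by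
    intro x n g h
    rw [show Valued.v x = Valued.v (2 ^ n * x) / exp (-(n : ℤ)) by
      rw [Valuation.map_mul, hpow, mul_div_cancel_left₀ _ exp_ne_zero],
      div_le_iff₀ (zero_lt_iff.mpr exp_ne_zero)]
    exact h.trans_eq (mul_comm _ _)
  have hscale' : ∀ {x : Kv} (n : ℕ) {g : WithZero (Multiplicative ℤ)},
      Valued.v (2 ^ n * x) = exp (-(n : ℤ)) * g → Valued.v x = g := by
    intro x n g h
    rw [show Valued.v x = Valued.v (2 ^ n * x) / exp (-(n : ℤ)) by
      rw [Valuation.map_mul, hpow, mul_div_cancel_left₀ _ exp_ne_zero],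
      div_eq_iff exp_ne_zero]
    exact h.trans (mul_comm _ _)
  have hεK : (ε : Kv) ^ 2 = 1 := by
    rcases hε with rfl | rfl <;> norm_num
  have hεv : Valued.v (ε : Kv) = 1 := by
    rcases hε with rfl | rfl <;> simp
  -- `a₁ = 4α₁`, `a₂ = 2P`, `a₃ = 32θ`, `a₄ = 8q`, `a₆ = 8r`
  set α₁ : Kv := φ X.a₁ / 2 ^ 2 with hα₁
  set P : Kv := φ X.a₂ / 2 ^ 1 with hP
  set θ : Kv := φ X.a₃ / 2 ^ 5 with hθ
  set q : Kv := φ X.a₄ / 2 ^ 3 with hq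
  set r : Kv := φ X.a₆ / 2 ^ 3 with hr
  have ha₁ : φ X.a₁ = 2 ^ 2 * α₁ := by rw [hα₁, mul_div_cancel₀ _ (hpow0 2)]
  have ha₂ : φ X.a₂ = 2 ^ 1 * P := by rw [hP, mul_div_cancel₀ _ (hpow0 1)]
  have ha₃ : φ X.a₃ = 2 ^ 5 * θ := by rw [hθ, mul_div_cancel₀ _ (hpow0 5)]
  have ha₄ : φ X.a₄ = 2 ^ 3 * q := by rw [hq, mul_div_cancel₀ _ (hpow0 3)]
  have ha₆ : φ X.a₆ = 2 ^ 3 * r := by rw [hr, mul_div_cancel₀ _ (hpow0 3)]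
  have hα₁v : Valued.v α₁ ≤ 1 :=
    hscale 2 (by rw [← ha₁, ← hval, mul_one]; exact h₁)
  have hPv : Valued.v P ≤ 1 :=
    hscale 1 (by rw [← ha₂, ← hval, mul_one]; simpa using h₂)
  have hθv : Valued.v θ ≤ 1 :=
    hscale 5 (by rw [← ha₃, ← hval, mul_one]; exact h₃)
  have hqv : Valued.v q ≤ 1 :=
    hscale 3 (by rw [← ha₄, ← hval, mul_one]; exact h₄)
  have hrv : Valued.v r = 1 :=
    hscale' 3 (by rw [← ha₆, ← hval, mul_one]; exact h₆)
  -- the sign: `v(r - ε) ≥ 2`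
  have hrε : Valued.v (r - ε) ≤ exp (-2 : ℤ) := by
    refine hscale 3 ?_
    have e : (2 : Kv) ^ 3 * (r - ε) = φ (X.a₆ - 8 * ε) := by
      rw [map_sub, map_mul, map_ofNat, map_intCast, ha₆]; ring
    rw [e, ← hval, ← exp_add]
    exact h₆ε.trans (hexp (by norm_num))
  -- `2`-adic congruences
  have hunit : ∀ {x : Kv}, Valued.v x = 1 → Valued.v (x - 1) ≤ exp (-1 : ℤ) := fun {x} hx ↦
    valued_le_exp_neg_one_of_lt_one v
      ((valued_lt_one_or_valued_sub_one_lt_one v hv2 hx.le).resolve_left (by rw [hx]; exact lt_irrefl 1))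
  have hprod : ∀ {x : Kv}, Valued.v x ≤ 1 → Valued.v (x * (x - 1)) ≤ exp (-1 : ℤ) := by
    intro x hx
    rw [Valuation.map_mul]
    rcases valued_lt_one_or_valued_sub_one_lt_one v hv2 hx with h | h
    · exact (mul_le_mul' (valued_le_exp_neg_one_of_lt_one v h)
        (Valuation.map_sub_le _ hx (by rw [Valuation.map_one]))).trans (by rw [mul_one])
    · exact (mul_le_mul' hx (valued_le_exp_neg_one_of_lt_one v h)).trans (by rw [one_mul])
  -- `P ≡ q (mod 2)` from `2⁷ ∣ b₈ = 2⁶ (2α₁²r + (Pr - q²) - 2⁴α₁θq + 2⁵Pθ²)`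
  set w : Kv := φ X.b₈ / 2 ^ 6 with hw
  have hb₈w : φ X.b₈ = 2 ^ 6 * w := by rw [hw, mul_div_cancel₀ _ (hpow0 6)]
  have hwv : Valued.v w ≤ exp (-1 : ℤ) :=
    hscale 6 (by rw [← hb₈w, ← hval, ← exp_add]; exact h₈.trans (hexp (by norm_num)))
  have hexpand : φ X.b₈ = (φ X.a₁) ^ 2 * φ X.a₆ + 4 * φ X.a₂ * φ X.a₆ - φ X.a₁ * φ X.a₃ * φ X.a₄ +
      φ X.a₂ * (φ X.a₃) ^ 2 - (φ X.a₄) ^ 2 := by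
    simp only [WeierstrassCurve.b₈, map_add, map_sub, map_mul, map_pow, map_ofNat]
  rw [ha₁, ha₂, ha₃, ha₄, ha₆] at hexpand
  have hid : P * r - q ^ 2 = w - 2 * α₁ ^ 2 * r + 2 ^ 4 * α₁ * θ * q - 2 ^ 5 * P * θ ^ 2 := by
    apply mul_left_cancel₀ (hpow0 6)
    linear_combination hexpand.symm.trans hb₈w
  have hin : Valued.v (P * r - q ^ 2) ≤ exp (-1 : ℤ) := by
    rw [hid]
    refine Valuation.map_sub_le _ (Valuation.map_add_le _ (Valuation.map_sub_le _ hwv ?_) ?_) ?_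
    · rw [Valuation.map_mul, Valuation.map_mul, V2, Valuation.map_pow, hrv, mul_one]
      exact (mul_le_mul' le_rfl (pow_le_one' hα₁v 2)).trans (by rw [mul_one])
    · rw [Valuation.map_mul, Valuation.map_mul, Valuation.map_mul, hpow]
      calc exp (-((4 : ℕ) : ℤ)) * Valued.v α₁ * Valued.v θ * Valued.v q
          ≤ exp (-((4 : ℕ) : ℤ)) * 1 * 1 * 1 :=
            mul_le_mul' (mul_le_mul' (mul_le_mul' le_rfl hα₁v) hθv) hqv
        _ ≤ exp (-1 : ℤ) := by rw [mul_one, mul_one, mul_one]; exact hexp (by norm_num)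
    · rw [Valuation.map_mul, Valuation.map_mul, hpow, Valuation.map_pow]
      calc exp (-((5 : ℕ) : ℤ)) * Valued.v P * Valued.v θ ^ 2 ≤ exp (-((5 : ℕ) : ℤ)) * 1 * 1 ^ 2 :=
            mul_le_mul' (mul_le_mul' le_rfl hPv) (pow_le_pow_left' hθv 2)
        _ ≤ exp (-1 : ℤ) := by rw [mul_one, one_pow, mul_one]; exact hexp (by norm_num)
  have hPq : Valued.v (P - q) ≤ exp (-1 : ℤ) := by
    have e : P - q = (P * r - q ^ 2) - P * (r - 1) + q * (q - 1) := by ring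
    rw [e]
    refine Valuation.map_add_le _ (Valuation.map_sub_le _ hin ?_) (hprod hqv)
    rw [Valuation.map_mul]; exact (mul_le_mul' hPv (hunit hrv)).trans (by rw [one_mul])
  -- the coefficients of `Xd = X.quadraticTwist (2ε)` in `K_v`
  set Xd := X.quadraticTwist (2 * ε) with hXd
  have hA₁ : Xd.a₁ = 0 := rfl
  have hA₃ : Xd.a₃ = 0 := rfl
  have h4Q : (4 : ℚ) ≠ 0 := by norm_num
  have h2Q : (2 : ℚ) ≠ 0 := two_ne_zero
  have hA₂ : φ Xd.a₂ = 2 ^ 2 * (ε * (2 * α₁ ^ 2 + P)) := by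
    have e : 4 * Xd.a₂ = (2 * ε) * X.b₂ := by
      rw [hXd, quadraticTwist_a₂, mul_div_cancel₀ _ h4Q]
    have e' := congrArg φ e
    simp only [WeierstrassCurve.b₂, map_mul, map_add, map_pow, map_ofNat, map_intCast] at e'
    rw [ha₁, ha₂] at e'
    apply mul_left_cancel₀ (hpow0 2)
    linear_combination e'
  have hA₄ : φ Xd.a₄ = 2 ^ 4 * (2 * q + 2 ^ 4 * α₁ * θ) := by
    have e : 2 * Xd.a₄ = (2 * ε) ^ 2 * X.b₄ := by
      rw [hXd, quadraticTwist_a₄, mul_div_cancel₀ _ h2Q]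
    have e' := congrArg φ e
    simp only [WeierstrassCurve.b₄, map_mul, map_add, map_pow, map_ofNat, map_intCast] at e'
    rw [ha₁, ha₃, ha₄] at e'
    apply mul_left_cancel₀ h20
    linear_combination e' + (2 * (2 ^ 3 * q) + 2 ^ 2 * α₁ * (2 ^ 5 * θ)) * (4 : Kv) * hεK
  have hA₆ : φ Xd.a₆ = 2 ^ 6 * (ε * r + 2 ^ 5 * ε * θ ^ 2) := by
    have e : 4 * Xd.a₆ = (2 * ε) ^ 3 * X.b₆ := by
      rw [hXd, quadraticTwist_a₆, mul_div_cancel₀ _ h4Q]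
    have e' := congrArg φ e
    simp only [WeierstrassCurve.b₆, map_mul, map_add, map_pow, map_ofNat, map_intCast] at e'
    rw [ha₃, ha₆] at e'
    apply mul_left_cancel₀ (hpow0 2)
    linear_combination e' + (2 * ε * ((2 ^ 5 * θ) ^ 2 + 4 * (2 ^ 3 * r))) * (4 : Kv) * hεK
  have hΔd : φ Xd.Δ = 2 ^ 6 * φ X.Δ := by
    rw [hXd, quadraticTwist_Δ, map_mul, map_pow, map_mul, map_ofNat, map_intCast, mul_pow,
      show ((ε : Kv)) ^ 6 = ((ε : Kv) ^ 2) ^ 3 by ring, hεK]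
    ring
  -- the change of variables `(2; 0, 2s₀, 8)`: coefficients (over `ℚ`, cleared of denominators)
  set u₂ : ℚˣ := Units.mk0 2 h2Q with hu₂
  have hu₂inv : ((u₂⁻¹ : ℚˣ) : ℚ) = 1 / 2 := by rw [Units.val_inv_eq_inv_val, hu₂, Units.val_mk0]; ring
  have coef : ∀ s₀ : ℚ,
      ((⟨u₂, 0, 2 * s₀, 8⟩ : VariableChange ℚ) • Xd).a₁ = 2 * s₀ ∧
      2 ^ 2 * ((⟨u₂, 0, 2 * s₀, 8⟩ : VariableChange ℚ) • Xd).a₂ = Xd.a₂ - 4 * s₀ ^ 2 ∧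
      ((⟨u₂, 0, 2 * s₀, 8⟩ : VariableChange ℚ) • Xd).a₃ = 2 ∧
      2 ^ 4 * ((⟨u₂, 0, 2 * s₀, 8⟩ : VariableChange ℚ) • Xd).a₄ = Xd.a₄ - 32 * s₀ ∧
      2 ^ 6 * ((⟨u₂, 0, 2 * s₀, 8⟩ : VariableChange ℚ) • Xd).a₆ = Xd.a₆ - 64 ∧
      2 ^ 12 * ((⟨u₂, 0, 2 * s₀, 8⟩ : VariableChange ℚ) • Xd).Δ = Xd.Δ := by
    intro s₀
    refine ⟨?_, ?_, ?_, ?_, ?_, ?_⟩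
    · rw [variableChange_a₁, hA₁, hu₂inv]; ring
    · rw [variableChange_a₂, hA₁, hu₂inv]; ring
    · rw [variableChange_a₃, hA₁, hA₃, hu₂inv]; ring
    · rw [variableChange_a₄, hA₁, hA₃, hu₂inv]; ring
    · rw [variableChange_a₆, hA₁, hA₃, hu₂inv]; ring
    · rw [variableChange_Δ, hu₂inv]; ring
  -- common estimates (in `K_v`)
  have hY₆ : Valued.v (ε * (r - ε) + 2 ^ 5 * ε * θ ^ 2) ≤ exp (-2 : ℤ) := by
    refine Valuation.map_add_le _ ?_ ?_
    · rw [Valuation.map_mul, hεv, one_mul]; exact hrε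
    · rw [Valuation.map_mul, Valuation.map_mul, hpow, hεv, mul_one, Valuation.map_pow]
      calc exp (-((5 : ℕ) : ℤ)) * Valued.v θ ^ 2 ≤ exp (-((5 : ℕ) : ℤ)) * 1 ^ 2 :=
            mul_le_mul' le_rfl (pow_le_pow_left' hθv 2)
        _ ≤ exp (-2 : ℤ) := by rw [one_pow, mul_one]; exact hexp (by norm_num)
  have hY₄ : ∀ {s₀ : Kv}, Valued.v (q - s₀) ≤ exp (-1 : ℤ) →
      Valued.v (2 * (q - s₀) + 2 ^ 4 * α₁ * θ) ≤ exp (-2 : ℤ) := by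
    intro s₀ hs
    refine Valuation.map_add_le _ ?_ ?_
    · rw [Valuation.map_mul, V2, show exp (-2 : ℤ) = exp (-1 : ℤ) * exp (-1 : ℤ) by
        rw [← exp_add]; norm_num]
      exact mul_le_mul' le_rfl hs
    · rw [Valuation.map_mul, Valuation.map_mul, hpow]
      calc exp (-((4 : ℕ) : ℤ)) * Valued.v α₁ * Valued.v θ ≤ exp (-((4 : ℕ) : ℤ)) * 1 * 1 :=
            mul_le_mul' (mul_le_mul' le_rfl hα₁v) hθv
        _ ≤ exp (-2 : ℤ) := by rw [mul_one, mul_one]; exact hexp (by norm_num)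
  have hφ2 : Valued.v (φ 2) = exp (-1 : ℤ) := by rw [map_ofNat, V2]
  -- valuation of a coefficient `y` from an identity `2ⁿ · y = …` over `ℚ`
  have fromQ : ∀ {y z : ℚ} (n : ℕ) {g : WithZero (Multiplicative ℤ)},
      (2 : ℚ) ^ n * y = z → Valued.v (φ z) ≤ exp (-(n : ℤ)) * g → v.valuation ℚ y ≤ g := by
    intro y z n g hyz hz
    rw [hval]
    refine hscale n ?_
    have : (2 : Kv) ^ n * φ y = φ z := by rw [← hyz, map_mul, map_pow, map_ofNat]
    rw [this]; exact hz
  have fromQ' : ∀ {y z : ℚ} (n : ℕ) {g : WithZero (Multiplicative ℤ)},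
      (2 : ℚ) ^ n * y = z → Valued.v (φ z) = exp (-(n : ℤ)) * g → v.valuation ℚ y = g := by
    intro y z n g hyz hz
    rw [hval]
    refine hscale' n ?_
    have : (2 : Kv) ^ n * φ y = φ z := by rw [← hyz, map_mul, map_pow, map_ofNat]
    rw [this]; exact hz
  by_cases hpar : Valued.v P < 1
  · -- `s₀ = 0`
    have hP1 : Valued.v P ≤ exp (-1 : ℤ) := valued_le_exp_neg_one_of_lt_one v hpar
    have hq1 : Valued.v (q - 0) ≤ exp (-1 : ℤ) := by
      rw [sub_zero]
      have e : q = P - (P - q) := by ring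
      rw [e]; exact Valuation.map_sub_le _ hP1 hPq
    obtain ⟨c₁, c₂, c₃, c₄, c₆, cΔ⟩ := coef 0
    refine ⟨⟨u₂, 0, 2 * 0, 8⟩, ?_, ?_, ?_, ?_, ?_, ?_⟩
    · rw [c₁, mul_zero, Valuation.map_zero]; exact zero_le
    · refine fromQ 2 c₂ ?_
      rw [map_sub, hA₂, map_mul, map_pow, map_zero, map_ofNat]
      simp only [ne_eq, OfNat.ofNat_ne_zero, not_false_eq_true, zero_pow, mul_zero, sub_zero, Nat.cast_ofNat,
        Nat.cast_one]
      rw [Valuation.map_mul, hpow, Valuation.map_mul, hεv, one_mul]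
      refine mul_le_mul' (by norm_num) (Valuation.map_add_le _ ?_ hP1)
      rw [Valuation.map_mul, V2, Valuation.map_pow]
      exact (mul_le_mul' le_rfl (pow_le_one' hα₁v 2)).trans (by rw [mul_one])
    · rw [c₃, hval, hφ2]; exact hexp (by norm_num)
    · refine fromQ 4 c₄ ?_
      rw [map_sub, hA₄, map_mul, map_ofNat, map_zero, mul_zero, sub_zero, Valuation.map_mul, hpow,
        Nat.cast_ofNat]
      refine mul_le_mul' (by norm_num) ?_
      have := hY₄ (s₀ := 0) hq1
      rw [sub_zero] at this
      exact this.trans (hexp (by norm_num))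
    · refine fromQ 6 c₆ ?_
      rw [map_sub, map_ofNat, hA₆, Nat.cast_ofNat, show (2 : Kv) ^ 6 * (ε * r + 2 ^ 5 * ε * θ ^ 2) - 64 =
        2 ^ 6 * (ε * (r - ε) + 2 ^ 5 * ε * θ ^ 2) by linear_combination (2 : Kv) ^ 6 * hεK]
      rw [Valuation.map_mul, hpow]
      exact mul_le_mul' (by norm_num) hY₆
    · refine fromQ' 12 cΔ ?_
      rw [hΔd, Valuation.map_mul, hpow, ← hval, hΔ, Nat.cast_ofNat, ← exp_add, ← exp_add]
      norm_num
  · -- `s₀ = 1`: `P` is a unit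
    have hP1 : Valued.v P = 1 := le_antisymm hPv (not_lt.mp hpar)
    have hq1 : Valued.v (q - 1) ≤ exp (-1 : ℤ) := by
      have e : q - 1 = (P - 1) - (P - q) := by ring
      rw [e]; exact Valuation.map_sub_le _ (hunit hP1) hPq
    obtain ⟨c₁, c₂, c₃, c₄, c₆, cΔ⟩ := coef 1
    refine ⟨⟨u₂, 0, 2 * 1, 8⟩, ?_, ?_, ?_, ?_, ?_, ?_⟩
    · rw [c₁, mul_one, hval, hφ2]; exact hexp (by norm_num)
    · refine fromQ 2 c₂ ?_
      rw [map_sub, hA₂, map_mul, map_pow, map_one, map_ofNat, one_pow, mul_one, Nat.cast_ofNat, Nat.cast_one,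
        show (2 : Kv) ^ 2 * (ε * (2 * α₁ ^ 2 + P)) - 4 =
          2 ^ 2 * (2 * (ε * α₁ ^ 2) + ε * (P - 1) + (ε - 1)) by ring,
        Valuation.map_mul, hpow]
      refine mul_le_mul' (by norm_num) (Valuation.map_add_le _ (Valuation.map_add_le _ ?_ ?_) ?_)
      · rw [Valuation.map_mul, V2, Valuation.map_mul, hεv, one_mul, Valuation.map_pow]
        exact (mul_le_mul' le_rfl (pow_le_one' hα₁v 2)).trans (by rw [mul_one])
      · rw [Valuation.map_mul, hεv, one_mul]; exact hunit hP1
      · rcases hε with rfl | rfl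
        · simp
        · rw [show ((-1 : ℤ) : Kv) - 1 = -2 by norm_num, Valuation.map_neg]; exact V2.le
    · rw [c₃, hval, hφ2]; exact hexp (by norm_num)
    · refine fromQ 4 c₄ ?_
      rw [map_sub, hA₄, map_mul, map_ofNat, map_one, mul_one, Nat.cast_ofNat,
        show (2 : Kv) ^ 4 * (2 * q + 2 ^ 4 * α₁ * θ) - 32 = 2 ^ 4 * (2 * (q - 1) + 2 ^ 4 * α₁ * θ) by ring,
        Valuation.map_mul, hpow]
      exact mul_le_mul' (by norm_num) ((hY₄ hq1).trans (hexp (by norm_num)))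
    · refine fromQ 6 c₆ ?_
      rw [map_sub, map_ofNat, hA₆, Nat.cast_ofNat, show (2 : Kv) ^ 6 * (ε * r + 2 ^ 5 * ε * θ ^ 2) - 64 =
        2 ^ 6 * (ε * (r - ε) + 2 ^ 5 * ε * θ ^ 2) by linear_combination (2 : Kv) ^ 6 * hεK]
      rw [Valuation.map_mul, hpow]
      exact mul_le_mul' (by norm_num) hY₆
    · refine fromQ' 12 cΔ ?_
      rw [hΔd, Valuation.map_mul, hpow, ← hval, hΔ, Nat.cast_ofNat, ← exp_add, ← exp_add]
      norm_num

end WeierstrassCurve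

namespace WeierstrassCurve

open Literature.NumberTheory.EllipticCurves Literature.NumberTheory.GaloisRepresentations
  Literature.NumberTheory.DiophantineGeometry Literature.NumberTheory.DiophantineGeometry.TateAlgorithm
  IsDedekindDomain.HeightOneSpectrum Rat.HeightOneSpectrum

variable (W : WeierstrassCurve ℚ)

/-- At a place above `2` of `ℚ`: an `8·(2-adic unit)` is `≡ 8` or `≡ -8 (mod 32)`. [folklore] -/
theorem Rat.valuation_sub_eight_le_or_of_valuation_eq {v : HeightOneSpectrum (𝓞 ℚ)}
    (hv : (2 : 𝓞 ℚ) ∈ v.asIdeal) {x : ℚ} (hx : v.valuation ℚ x = exp (-3 : ℤ)) :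
    v.valuation ℚ (x - 8) ≤ exp (-5 : ℤ) ∨ v.valuation ℚ (x + 8) ≤ exp (-5 : ℤ) := by
  have hv2 : natGenerator v = 2 := Rat.natGenerator_eq_two hv
  have hval : ∀ y : ℚ, v.valuation ℚ y = Valued.v (algebraMap ℚ (v.adicCompletion ℚ) y) := fun y ↦ by
    rw [valued_algebraMap_adicCompletion]
  have V2 : Valued.v (2 : v.adicCompletion ℚ) = exp (-1 : ℤ) := valued_two v hv2
  have h20 : (2 : v.adicCompletion ℚ) ≠ 0 := by
    intro h; rw [h, Valuation.map_zero] at V2; exact exp_ne_zero V2.symm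
  have V8 : Valued.v ((2 : v.adicCompletion ℚ) ^ 3) = exp (-3 : ℤ) := by
    rw [Valuation.map_pow, V2, ← exp_nsmul]; norm_num
  set r : v.adicCompletion ℚ := algebraMap ℚ _ x / 2 ^ 3 with hr
  have hrv : Valued.v r = 1 := by
    rw [hr, map_div₀, V8, div_eq_iff exp_ne_zero, one_mul, ← hval, hx]
  have hx' : algebraMap ℚ (v.adicCompletion ℚ) x = 2 ^ 3 * r := by
    rw [hr, mul_div_cancel₀ _ (pow_ne_zero 3 h20)]
  -- `r - 1 = 2ρ`, and `ρ ≡ 0` or `1 (mod 2)`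
  have hr1 : Valued.v (r - 1) ≤ exp (-1 : ℤ) :=
    valued_le_exp_neg_one_of_lt_one v
      ((valued_lt_one_or_valued_sub_one_lt_one v hv2 hrv.le).resolve_left (by rw [hrv]; exact lt_irrefl 1))
  set ρ : v.adicCompletion ℚ := (r - 1) / 2 with hρ
  have hρv : Valued.v ρ ≤ 1 := by
    rw [hρ, map_div₀, V2, div_le_iff₀ (zero_lt_iff.mpr exp_ne_zero), one_mul]; exact hr1
  have hrρ : r - 1 = 2 * ρ := by rw [hρ, mul_div_cancel₀ _ h20]
  have key : ∀ {y : v.adicCompletion ℚ}, Valued.v y ≤ exp (-1 : ℤ) →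
      Valued.v (2 ^ 3 * (2 * y)) ≤ exp (-5 : ℤ) := by
    intro y hy
    rw [Valuation.map_mul, Valuation.map_mul, V8, V2, ← mul_assoc, ← exp_add]
    exact (mul_le_mul' le_rfl hy).trans (by rw [← exp_add, exp_le_exp]; norm_num)
  rcases valued_lt_one_or_valued_sub_one_lt_one v hv2 hρv with h | h
  · left
    rw [hval, map_sub, map_ofNat, hx', show (2 : v.adicCompletion ℚ) ^ 3 * r - 8 = 2 ^ 3 * (r - 1) by ring,
      hrρ]
    exact key (valued_le_exp_neg_one_of_lt_one v h)
  · right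
    rw [hval, map_add, map_ofNat, hx',
      show (2 : v.adicCompletion ℚ) ^ 3 * r + 8 = 2 ^ 3 * ((r - 1) + 2) by ring, hrρ,
      show (2 : v.adicCompletion ℚ) * ρ + 2 = 2 * ((ρ - 1) + 2) by ring]
    refine key (Valuation.map_add_le _ (valued_le_exp_neg_one_of_lt_one v h) V2.le)

/-- **Type `I₀*` with `ord₂ Δ_min = 10` over `ℚ`: a `ℚ`-model with `ord₂(a₁) ≥ 2`, `ord₂(a₂) ≥ 1`,
`ord₂(a₃) ≥ 5`, `ord₂(a₄) ≥ 3`, `ord₂(a₆) = 3`, `ord₂(Δ) = 10`, the dichotomy `ord₂(b₈) ≥ 7`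
(`Φ = C₆`) or `ord₂(b₈) = 6`, and the sign `32 ∣ a₆ - 8` or `32 ∣ a₆ + 8`** (the canonical normal
form of `exists_smul_a_of_kodairaSymbolOfMinimal_eq_Istar_zero_of_two_of_addVal_eq_ten` made
`ℚ`-rational by `exists_variableChange_valuation_shape_of_two`; `a₆/8` is a `2`-adic unit, hence
`≡ ±1 (mod 4)`). [cite: SilvermanATAEC1994, IV.9.4 Step 6 and Table 4.1] -/
theorem exists_variableChange_of_kodairaSymbolAt_Istar_zero_of_ordMinimalDiscriminant_eq_ten
    [W.IsElliptic] {v : HeightOneSpectrum (𝓞 ℚ)} (hv : (2 : 𝓞 ℚ) ∈ v.asIdeal)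
    (hT : W.kodairaSymbolAt v = .Istar 0) (hord : W.ordMinimalDiscriminant v = 10) :
    ∃ C : VariableChange ℚ,
      v.valuation ℚ (C • W).a₁ ≤ exp (-2 : ℤ) ∧ v.valuation ℚ (C • W).a₂ ≤ exp (-1 : ℤ) ∧
      v.valuation ℚ (C • W).a₃ ≤ exp (-5 : ℤ) ∧ v.valuation ℚ (C • W).a₄ ≤ exp (-3 : ℤ) ∧
      v.valuation ℚ (C • W).a₆ = exp (-3 : ℤ) ∧ v.valuation ℚ (C • W).Δ = exp (-10 : ℤ) ∧
      (v.valuation ℚ (C • W).b₈ ≤ exp (-7 : ℤ) ∨ v.valuation ℚ (C • W).b₈ = exp (-6 : ℤ)) ∧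
      (v.valuation ℚ ((C • W).a₆ - 8) ≤ exp (-5 : ℤ) ∨ v.valuation ℚ ((C • W).a₆ + 8) ≤ exp (-5 : ℤ)) := by
  have h2 := Rat.valuation_two_of_two_mem hv
  have h2irr := irreducible_two_adicCompletionIntegers v h2
  have hT' := hT
  rw [kodairaSymbolAt_def] at hT'
  have hΔ10 : (IsDiscreteValuationRing.addVal (v.adicCompletionIntegers ℚ)
      (W.localMinimalIntegralModel v).Δ).toNat = 10 := by
    rw [← hord, ordMinimalDiscriminant]
  obtain ⟨D, ha₁, ha₂, ha₃, ha₄, ⟨r, hr, ha₆⟩, hb₈, hΔ⟩ :=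
    LocalIndex.exists_smul_a_of_kodairaSymbolOfMinimal_eq_Istar_zero_of_two_of_addVal_eq_ten h2irr _
      hT' hΔ10
  have ha₃' : (2 : v.adicCompletionIntegers ℚ) ^ 5 ∣ (D • W.localMinimalIntegralModel v).a₃ := by
    rw [ha₃]; exact dvd_zero _
  have ha₆c : (2 : v.adicCompletionIntegers ℚ) ^ 0 ∣ ((D • W.localMinimalIntegralModel v).a₆ - (0 : ℤ)) :=
    ⟨_, (one_mul _).symm⟩
  have hb₈6 : (2 : v.adicCompletionIntegers ℚ) ^ 6 ∣ (D • W.localMinimalIntegralModel v).b₈ := by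
    rcases hb₈ with ⟨w, hw⟩ | ⟨w, -, hw⟩
    · exact ⟨2 * w, by rw [hw]; ring⟩
    · exact ⟨w, hw⟩
  have finish : ∀ C : VariableChange ℚ,
      v.valuation ℚ (C • W).a₆ = exp (-3 : ℤ) →
      (v.valuation ℚ ((C • W).a₆ - 8) ≤ exp (-5 : ℤ) ∨ v.valuation ℚ ((C • W).a₆ + 8) ≤ exp (-5 : ℤ)) :=
    fun C h ↦ Rat.valuation_sub_eight_le_or_of_valuation_eq hv h
  rcases hb₈ with hb₈ | ⟨w, hw, hb₈⟩
  · obtain ⟨-, C, h₁, h₂', h₃, -, h₄, h₆, -, h₈, -, hΔ'⟩ := W.exists_variableChange_valuation_shape_of_two v h2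
      (k₁ := 2) (k₂ := 1) (k₃ := 5) (k₄ := 3) (k₆ := 3) (k₈ := 7) (n := 10) D
      ha₁ (by simpa using ha₂) ha₃' ha₄ ⟨r, hr, ha₆⟩ 0 ha₆c hb₈ hΔ
    exact ⟨C, by simpa using h₁, by simpa using h₂', by simpa using h₃, by simpa using h₄,
      by simpa using h₆, by simpa using hΔ', Or.inl (by simpa using h₈), finish C (by simpa using h₆)⟩
  · obtain ⟨-, C, h₁, h₂', h₃, -, h₄, h₆, -, -, h₈, hΔ'⟩ := W.exists_variableChange_valuation_shape_of_two v h2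
      (k₁ := 2) (k₂ := 1) (k₃ := 5) (k₄ := 3) (k₆ := 3) (k₈ := 6) (n := 10) D
      ha₁ (by simpa using ha₂) ha₃' ha₄ ⟨r, hr, ha₆⟩ 0 ha₆c hb₈6 hΔ
    exact ⟨C, by simpa using h₁, by simpa using h₂', by simpa using h₃, by simpa using h₄,
      by simpa using h₆, by simpa using hΔ', Or.inr (by simpa using h₈ hw hb₈), finish C (by simpa using h₆)⟩

/-- **The twist by `2ε` of a `C₆`-curve of type `I₀*`, `ord₂ Δ_min = 10`, `a₆ ≡ 8ε (mod 32)`, is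
potentially good over `ℚ(∛2)`** (the type-`IV` shape of `(2; 0, 2s₀, 8) • (C • W)^{(2ε)}`,
`exists_variableChange_quadraticTwist_two_mul_of_Istar_zero_ten_of_valuation_b₈_le`, transported to
`W^{(2ε)}` by `quadraticTwist_smul`; `hasGoodReductionAt_baseChange_of_pow_three_eq` with `j = 1`).
[cite: SilvermanATAEC1994, IV.9.4 Steps 5–6; proof of Thm. IV.10.2(b) (PDF pp. 359–361)]
[cite: SilvermanAEC2009, VII.5 Prop. 5.4, X.5 Cor. 5.4] -/
theorem hasGoodReductionAt_baseChange_quadraticTwist_two_mul_of_Istar_zero_ten_of_valuation_b₈_le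
    {v : HeightOneSpectrum (𝓞 ℚ)} (hv : (2 : 𝓞 ℚ) ∈ v.asIdeal) {ε : ℤ} (hε : ε = 1 ∨ ε = -1)
    (C : VariableChange ℚ)
    (h₁ : v.valuation ℚ (C • W).a₁ ≤ exp (-2 : ℤ)) (h₂ : v.valuation ℚ (C • W).a₂ ≤ exp (-1 : ℤ))
    (h₃ : v.valuation ℚ (C • W).a₃ ≤ exp (-5 : ℤ)) (h₄ : v.valuation ℚ (C • W).a₄ ≤ exp (-3 : ℤ))
    (h₆ : v.valuation ℚ (C • W).a₆ = exp (-3 : ℤ))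
    (h₆ε : v.valuation ℚ ((C • W).a₆ - 8 * ε) ≤ exp (-5 : ℤ))
    (h₈ : v.valuation ℚ (C • W).b₈ ≤ exp (-7 : ℤ)) (hΔ : v.valuation ℚ (C • W).Δ = exp (-10 : ℤ))
    (L : Type*) [Field L] [NumberField L] [Algebra ℚ L] {β : L} (hβ : β ^ 3 = 2)
    {w : HeightOneSpectrum (𝓞 L)} (hw : w.asIdeal.under (𝓞 ℚ) = v.asIdeal) :
    ((W.quadraticTwist (2 * ε)).baseChange L).HasGoodReductionAt w := by
  obtain ⟨C', g₁, g₂, g₃, g₄, g₆, gΔ⟩ :=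
    (C • W).exists_variableChange_quadraticTwist_two_mul_of_Istar_zero_ten_of_valuation_b₈_le hv hε h₁
      h₂ h₃ h₄ h₆ h₆ε h₈ hΔ
  have htw : (C • W).quadraticTwist (2 * ε) =
      (⟨C.u, (2 * ε) * C.r, 0, 0⟩ : VariableChange ℚ) • W.quadraticTwist (2 * ε) := by
    exact_mod_cast quadraticTwist_smul W C ((2 * ε : ℤ) : ℚ)
  rw [htw, ← mul_smul] at g₁ g₂ g₃ g₄ g₆ gΔ
  have hβ' : β ^ 3 = algebraMap ℚ L 2 := by rw [hβ, map_ofNat]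
  exact (W.quadraticTwist (2 * ε)).hasGoodReductionAt_baseChange_of_pow_three_eq L
    (Rat.valuation_two_of_two_mem hv) hβ' 1 _ g₁ g₂ g₃ g₄ g₆ gΔ
    (by norm_num) (by norm_num) (by norm_num) (by norm_num) (by norm_num) (by norm_num) hw

variable (ℓ : ℕ) [Fact ℓ.Prime]

/-- **`Sw_𝔓(V_ℓ E) = 4` for the `C₆`-curves of type `I₀*`, `ord₂ Δ_min = 10`** (`ℓ ≠ 2`, `𝔓 ∣ 2`):
with `a₆ ≡ 8ε (mod 32)`, `E^{(2ε)}` is potentially good over `ℚ(∛2)`, and the break of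
`ℚ₂(√(2ε))` is `2` (`swanConductorAt_rationalTate_eq_four_of_quadraticTwist_of_emod_four_eq_two`).
Silverman, *ATAEC* IV.9 Table 4.1 (type `I₀*`, `f = 6`, `ord₂ Δ = 10`) with Thm. IV.10.2(b).
[cite: SilvermanATAEC1994, IV.9 Table 4.1, Thm. IV.10.2(b) (PDF pp. 358–361)] [cite: SerreTate1968, §3] -/
theorem swanConductorAt_rationalTate_eq_four_of_Istar_zero_ten_of_valuation_b₈_le [W.IsElliptic]
    (h : Continuous fun x : absoluteGaloisGroup ℚ × RationalTateModule (geomPoints W) ℓ ↦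
      rationalTateRepresentation (absoluteGaloisGroup ℚ) (geomPoints W) ℓ x.1 x.2)
    {v : HeightOneSpectrum (𝓞 ℚ)} (hv : (2 : 𝓞 ℚ) ∈ v.asIdeal) (hℓ : (ℓ : 𝓞 ℚ) ∉ v.asIdeal)
    {ε : ℤ} (hε : ε = 1 ∨ ε = -1) (C : VariableChange ℚ)
    (h₁ : v.valuation ℚ (C • W).a₁ ≤ exp (-2 : ℤ)) (h₂ : v.valuation ℚ (C • W).a₂ ≤ exp (-1 : ℤ))
    (h₃ : v.valuation ℚ (C • W).a₃ ≤ exp (-5 : ℤ)) (h₄ : v.valuation ℚ (C • W).a₄ ≤ exp (-3 : ℤ))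
    (h₆ : v.valuation ℚ (C • W).a₆ = exp (-3 : ℤ))
    (h₆ε : v.valuation ℚ ((C • W).a₆ - 8 * ε) ≤ exp (-5 : ℤ))
    (h₈ : v.valuation ℚ (C • W).b₈ ≤ exp (-7 : ℤ)) (hΔ : v.valuation ℚ (C • W).Δ = exp (-10 : ℤ))
    {𝔓 : Ideal (absIntegers (𝓞 ℚ) ℚ)} (h𝔓 : 𝔓 ∈ v.primesAbove) :
    (rationalTateGaloisRepOf (geomPoints W) ℓ h).swanConductorAt (𝓞 ℚ) 𝔓 = 4 := by
  have hd : (2 * ε) % 4 = 2 := by rcases hε with rfl | rfl <;> decide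
  have key := W.swanConductorAt_rationalTate_eq_four_of_quadraticTwist_of_emod_four_eq_two ℓ h hv hℓ hd
    (fun L _ _ _ β hβ w hw ↦ by
      have := W.hasGoodReductionAt_baseChange_quadraticTwist_two_mul_of_Istar_zero_ten_of_valuation_b₈_le
        hv hε C h₁ h₂ h₃ h₄ h₆ h₆ε h₈ hΔ L hβ hw
      simpa using this)
    h𝔓
  exact key

attribute [local instance] AddSubgroup.torsionBy.zmodModule in
/-- **Ogg's formula at `2` for the `C₆`-curves of type `I₀*`, `ord₂ Δ_min = 10`, `3`-torsion form**:
`Sw_𝔓(E[3]) = δ₂(E)`, both sides being `4` (`δ₂ = ord₂ Δ_min - 6`).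
[cite: SilvermanATAEC1994, §IV.10 Definition of δ(E/K) (PDF p. 358), Thm. IV.11.1 (pp. 365–366), Table 4.1]
[cite: Saito1988, Theorem 1] -/
theorem swanConductorAt_torsion_eq_wildConductorExponent_of_Istar_zero_ten_of_valuation_b₈_le
    [W.IsElliptic] {v : HeightOneSpectrum (𝓞 ℚ)} (hv : (2 : 𝓞 ℚ) ∈ v.asIdeal)
    (hT : W.kodairaSymbolAt v = .Istar 0) (hord : W.ordMinimalDiscriminant v = 10)
    {ε : ℤ} (hε : ε = 1 ∨ ε = -1) (C : VariableChange ℚ)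
    (h₁ : v.valuation ℚ (C • W).a₁ ≤ exp (-2 : ℤ)) (h₂ : v.valuation ℚ (C • W).a₂ ≤ exp (-1 : ℤ))
    (h₃ : v.valuation ℚ (C • W).a₃ ≤ exp (-5 : ℤ)) (h₄ : v.valuation ℚ (C • W).a₄ ≤ exp (-3 : ℤ))
    (h₆ : v.valuation ℚ (C • W).a₆ = exp (-3 : ℤ))
    (h₆ε : v.valuation ℚ ((C • W).a₆ - 8 * ε) ≤ exp (-5 : ℤ))
    (h₈ : v.valuation ℚ (C • W).b₈ ≤ exp (-7 : ℤ)) (hΔ : v.valuation ℚ (C • W).Δ = exp (-10 : ℤ))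
    {𝔓 : Ideal (absIntegers (𝓞 ℚ) ℚ)} (h𝔓 : 𝔓 ∈ v.primesAbove) :
    (W.torsionGaloisRep 3).swanConductorAt (𝓞 ℚ) 𝔓 = (W.wildConductorExponent v : ℝ) := by
  haveI : Fact (Nat.Prime 3) := ⟨Nat.prime_three⟩
  have h3 : ((3 : ℕ) : 𝓞 ℚ) ∉ v.asIdeal := by
    intro h3
    apply (Ideal.ne_top_iff_one v.asIdeal).mp v.isPrime.ne_top
    have := v.asIdeal.sub_mem h3 hv
    rwa [show ((3 : ℕ) : 𝓞 ℚ) - 2 = 1 by norm_num] at this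
  rw [← W.swanConductorAt_rationalTate_eq_swanConductorAt_torsion 3
    (W.continuous_rationalGaloisRepTate_holds 3) h3 h𝔓,
    W.swanConductorAt_rationalTate_eq_four_of_Istar_zero_ten_of_valuation_b₈_le 3 _ hv h3 hε C h₁ h₂ h₃
      h₄ h₆ h₆ε h₈ hΔ h𝔓,
    W.wildConductorExponent_eq_of_kodairaSymbolAt_Istar_zero v hT, hord]
  norm_num

end WeierstrassCurve

end
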